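import Literature.NumberTheory.Sieve.BombieriFriedlanderIwaniecTheorem7StarSwitchPadic
import HarnessLib

/-!
# Bombieri–Friedlander–Iwaniec 1986, Theorem 7* (§14): the `q ↔ s` switch, subdivision into cells

Topic `Literature/NumberTheory/Sieve`; continuation of `…Theorem7StarSwitchPadic`.  Everything here is
PROVED; no named fact is introduced.

BFI §13 p. 241–242: after the switch `q = (lmn − a)/(rs)` "… `s` runs through an interval dependent
on `m, n, r`.  By a subdivision argument we remove this dependence with an admissible error term".
This file is that subdivision argument for the (reduced, unit-class) switched counts `BFI.gcount` /
`BFI.gmodel` of `…SwitchPadic`: the variables are cut into cells; for a product cell the range of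
`s'` splits into an INSIDE part, on which the window `Q'r(gs') < lmn − a ≤ 2Q'r(gs')` holds for
every tuple of the cell — there the switched count is a plain congruence count and its `s'`-sum is a
signed combination of `8` sums `BFI.setQSum` over INITIAL ranges (`abs_sum_one_cell_le`,
`abs_Xred_le_sum_cells`), i.e. of
terms of `Δ*` for the data `(ã, l̃)` — an OUTSIDE part (no contribution), and two short AMBIGUOUS
ranges of `s'`, whose contribution is kept as an explicit nonnegative error (the count plus the model)
to be bounded on average in the sequel; on the ambiguous ranges the complementary divisor `q` lies in
two short windows (`mem_ambiguous_windows_red`).  Before the subdivision, the switched difference of one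
`(r, l)` term is reduced to unit classes and regrouped (`abs_switch_diff_le_sum_Xred`, using the
`p`-adic reduction of `…SwitchPadic` and the grouping modulus `Θ_d`, `coprime_ThetaD_div_iff`), and after
it the corner terms of a cell of `(r, l)` embed into `Δ*` of the reduced data
(`sum_mul_abs_setQSum_le_deltaStarSets`).

## References

* E. Bombieri, J. B. Friedlander, H. Iwaniec, *Primes in arithmetic progressions to large moduli*,
  Acta Math. 156 (1986), 203–251: §13 p. 241–242. [BombieriFriedlanderIwaniecActa1986]
-/

noncomputable section

open Finset Real

open scoped ArithmeticFunction.sigma ArithmeticFunction.Moebius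

namespace Literature.NumberTheory.Sieve

namespace BFI

/-! ### Vanishing of the reduced counts at moduli sharing a prime with `l̃` but not with `ã` -/

/-- If some `p` divides the modulus `w` and the coefficient `lc` but not `a`, the switched
congruence count vanishes. [folklore] -/
theorem gcount_eq_zero_of_prime_dvd {p : ℕ} {w lc : ℕ} (hpw : p ∣ w) (hpl : p ∣ lc)
    {a : ℤ} (hpa : ¬ (p : ℤ) ∣ a) (z : ℝ) (SM SN : Finset ℕ) (L₀ : ℕ) (lo hi : ℤ) :
    gcount a z SM SN lc L₀ w lo hi = 0 := by
  unfold gcount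
  refine Finset.sum_eq_zero fun m _ => Finset.sum_eq_zero fun n _ => ?_
  unfold dind
  rw [if_neg, zero_mul, zero_mul]
  intro hd
  have h1 : (p : ℤ) ∣ ((lc * m * n : ℕ) : ℤ) - a := (Int.natCast_dvd_natCast.2 hpw).trans hd
  have h2 : (p : ℤ) ∣ ((lc * m * n : ℕ) : ℤ) :=
    Int.natCast_dvd_natCast.2 (hpl.trans (Dvd.intro (m * n) (by ring)))
  have h3 : (p : ℤ) ∣ a := by have := dvd_sub h2 h1; rwa [sub_sub_cancel] at this
  exact hpa h3

/-- The same for the model. [folklore] -/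
theorem gmodel_eq_zero_of_prime_dvd {p : ℕ} {w lc : ℕ} (hpw : p ∣ w) (hpl : p ∣ lc)
    {a : ℤ} (hpa : ¬ (p : ℤ) ∣ a) (z : ℝ) (SM SN : Finset ℕ) (L₀ : ℕ) (lo hi : ℤ) :
    gmodel a z SM SN lc L₀ w lo hi = 0 := by
  unfold gmodel
  refine Finset.sum_eq_zero fun m _ => Finset.sum_eq_zero fun n _ => ?_
  unfold pmodel
  rw [if_neg, zero_mul, zero_mul]
  intro hg
  have h1 : p ∣ Nat.gcd (lc * m * n) w := Nat.dvd_gcd (hpl.trans (Dvd.intro (m * n) (by ring))) hpw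
  rw [hg] at h1
  have h2 : p ∣ a.natAbs := (h1.trans (Nat.gcd_dvd_left _ _))
  exact hpa (Int.natCast_dvd.2 h2)

/-! ### Additivity of the switched counts in the ranges -/

/-- `gcount` is additive in `SM`. [folklore] -/
theorem gcount_union_M (a : ℤ) (z : ℝ) {A B : Finset ℕ} (h : Disjoint A B) (SN : Finset ℕ)
    (lc L₀ w : ℕ) (lo hi : ℤ) :
    gcount a z (A ∪ B) SN lc L₀ w lo hi = gcount a z A SN lc L₀ w lo hi + gcount a z B SN lc L₀ w lo hi := by
  unfold gcount; rw [Finset.sum_union h]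

/-- `gcount` is additive in `SN`. [folklore] -/
theorem gcount_union_N (a : ℤ) (z : ℝ) (SM : Finset ℕ) {A B : Finset ℕ} (h : Disjoint A B)
    (lc L₀ w : ℕ) (lo hi : ℤ) :
    gcount a z SM (A ∪ B) lc L₀ w lo hi = gcount a z SM A lc L₀ w lo hi + gcount a z SM B lc L₀ w lo hi := by
  unfold gcount; rw [← Finset.sum_add_distrib]
  exact Finset.sum_congr rfl fun m _ => Finset.sum_union h

/-- `gmodel` is additive in `SM`. [folklore] -/
theorem gmodel_union_M (a : ℤ) (z : ℝ) {A B : Finset ℕ} (h : Disjoint A B) (SN : Finset ℕ)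
    (lc L₀ w : ℕ) (lo hi : ℤ) :
    gmodel a z (A ∪ B) SN lc L₀ w lo hi = gmodel a z A SN lc L₀ w lo hi + gmodel a z B SN lc L₀ w lo hi := by
  unfold gmodel; rw [Finset.sum_union h]

/-- `gmodel` is additive in `SN`. [folklore] -/
theorem gmodel_union_N (a : ℤ) (z : ℝ) (SM : Finset ℕ) {A B : Finset ℕ} (h : Disjoint A B)
    (lc L₀ w : ℕ) (lo hi : ℤ) :
    gmodel a z SM (A ∪ B) lc L₀ w lo hi = gmodel a z SM A lc L₀ w lo hi + gmodel a z SM B lc L₀ w lo hi := by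
  unfold gmodel; rw [← Finset.sum_add_distrib]
  exact Finset.sum_congr rfl fun m _ => Finset.sum_union h

/-- `setQSum` is additive in `SQ`. [folklore] -/
theorem setQSum_union_Q (a : ℤ) (z : ℝ) (SM SN : Finset ℕ) {A B : Finset ℕ} (h : Disjoint A B) (r l : ℕ) :
    setQSum a z SM SN (A ∪ B) r l = setQSum a z SM SN A r l + setQSum a z SM SN B r l := by
  unfold setQSum
  rw [Finset.filter_union, Finset.sum_union (Finset.disjoint_filter_filter h)]

/-- A sum over `Ioc (b 0) (b J)` as the sum over the consecutive cells `Ioc (b i) (b (i+1))` of a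
monotone sequence of breakpoints. [folklore] -/
theorem sum_Ioc_eq_sum_cells {b : ℕ → ℕ} (hb : Monotone b) (f : ℕ → ℝ) (J : ℕ) :
    ∑ m ∈ Ioc (b 0) (b J), f m = ∑ i ∈ range J, ∑ m ∈ Ioc (b i) (b (i + 1)), f m := by
  induction J with
  | zero => simp
  | succ J ih =>
    rw [Finset.sum_range_succ, ← ih, ← Finset.sum_union]
    · congr 1
      exact (Finset.Ioc_union_Ioc_eq_Ioc (hb (Nat.zero_le J)) (hb (Nat.le_succ J))).symm
    · exact Finset.Ioc_disjoint_Ioc_of_le le_rfl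

/-! ### The inside part of a cell: terms of `Δ*` over initial ranges -/

/-- **The `s'`-sum of the inside part is a window of `setQSum`.**  If on the cell `SM × SN` the window
holds for every `s' ∈ [S₁, S₂]`, `(a, R s') = (lc, R s') = 1` is automatic on the filter
`(s', a·lc) = 1` together with `(a, R) = (lc, R) = 1`, and the modulus is `R·s' = s'·R`, then
`∑_{S₁ ≤ s' ≤ S₂, (s', a lc)=1} (gcount − gmodel)(…, R s', lo(s'), hi(s')) = setQSum(…, Icc S₁ S₂, R, lc)`.
[cite: BombieriFriedlanderIwaniecActa1986, §13 p. 241–242] -/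
theorem sum_filter_sub_eq_setQSum (a : ℤ) (z : ℝ) (SM SN : Finset ℕ) {lc L₀ R : ℕ}
    (haR : Nat.Coprime a.natAbs R) (hlR : lc.Coprime R) (lo hi : ℕ → ℤ) {S₁ S₂ : ℕ}
    (hwin : ∀ s' ∈ Icc S₁ S₂, ∀ m ∈ SM, ∀ n ∈ SN,
      lo s' < ((L₀ * m * n : ℕ) : ℤ) ∧ ((L₀ * m * n : ℕ) : ℤ) ≤ hi s') :
    ∑ s' ∈ (Icc S₁ S₂).filter (fun s' : ℕ => IsCoprime (s' : ℤ) (a * lc)),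
        (gcount a z SM SN lc L₀ (R * s') (lo s') (hi s') - gmodel a z SM SN lc L₀ (R * s') (lo s') (hi s')) =
      setQSum a z SM SN (Icc S₁ S₂) R lc := by
  unfold setQSum
  refine Finset.sum_congr rfl fun s' hs' => ?_
  obtain ⟨hs'I, hcop⟩ := Finset.mem_filter.1 hs'
  rw [Int.isCoprime_iff_nat_coprime, Int.natAbs_natCast, Int.natAbs_mul, Int.natAbs_natCast,
    Nat.coprime_mul_iff_right] at hcop
  have haw : Nat.Coprime a.natAbs (R * s') := Nat.Coprime.mul_right haR hcop.1.symm
  have hlw : Nat.Coprime lc (R * s') := Nat.Coprime.mul_right hlR hcop.2.symm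
  rw [gcount_eq_setCongrCount_of_window a z lc (R * s') (hwin s' hs'I),
    gmodel_eq_setCoprimeCount_of_window z haw hlw (hwin s' hs'I), mul_comm R s']

/-- **A cell over a product of two intervals: four signed corners** (inclusion–exclusion inside,
triangle inequality outside). [folklore] -/
theorem abs_setQSum_Ioc_Ioc_le (a : ℤ) (z : ℝ) {m₁ m₂ n₁ n₂ : ℕ} (hm : m₁ ≤ m₂) (hn : n₁ ≤ n₂)
    (SQ : Finset ℕ) (r l : ℕ) :
    |setQSum a z (Ioc m₁ m₂) (Ioc n₁ n₂) SQ r l| ≤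
      |setQSum a z (Icc 1 m₂) (Icc 1 n₂) SQ r l| + |setQSum a z (Icc 1 m₁) (Icc 1 n₂) SQ r l| +
        |setQSum a z (Icc 1 m₂) (Icc 1 n₁) SQ r l| + |setQSum a z (Icc 1 m₁) (Icc 1 n₁) SQ r l| := by
  -- `Icc 1 m₂ = Icc 1 m₁ ∪ Ioc m₁ m₂` and the same for `n`
  have hIcc : ∀ {x y : ℕ}, x ≤ y → Icc 1 y = Icc 1 x ∪ Ioc x y := by
    intro x y hxy; ext i; simp only [Finset.mem_union, Finset.mem_Icc, Finset.mem_Ioc]; omega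
  have hdisj : ∀ x y : ℕ, Disjoint (Icc 1 x) (Ioc x y) := by
    intro x y; rw [Finset.disjoint_left]; intro i h1 h2
    simp only [Finset.mem_Icc] at h1; simp only [Finset.mem_Ioc] at h2; omega
  have eM : ∀ SN' : Finset ℕ, setQSum a z (Ioc m₁ m₂) SN' SQ r l =
      setQSum a z (Icc 1 m₂) SN' SQ r l - setQSum a z (Icc 1 m₁) SN' SQ r l := by
    intro SN'
    rw [hIcc hm, setQSum_union_M a z (hdisj m₁ m₂)]; ring
  have eN : ∀ SM' : Finset ℕ, setQSum a z SM' (Ioc n₁ n₂) SQ r l =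
      setQSum a z SM' (Icc 1 n₂) SQ r l - setQSum a z SM' (Icc 1 n₁) SQ r l := by
    intro SM'
    rw [hIcc hn, setQSum_union_N a z SM' (hdisj n₁ n₂)]; ring
  rw [eM, eN, eN]
  have t1 := abs_sub (setQSum a z (Icc 1 m₂) (Icc 1 n₂) SQ r l - setQSum a z (Icc 1 m₂) (Icc 1 n₁) SQ r l)
    (setQSum a z (Icc 1 m₁) (Icc 1 n₂) SQ r l - setQSum a z (Icc 1 m₁) (Icc 1 n₁) SQ r l)
  have t2 := abs_sub (setQSum a z (Icc 1 m₂) (Icc 1 n₂) SQ r l) (setQSum a z (Icc 1 m₂) (Icc 1 n₁) SQ r l)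
  have t3 := abs_sub (setQSum a z (Icc 1 m₁) (Icc 1 n₂) SQ r l) (setQSum a z (Icc 1 m₁) (Icc 1 n₁) SQ r l)
  linarith

/-- `setQSum` over `Icc S₁ S₂` as a difference of two initial ranges. [folklore] -/
theorem setQSum_Icc_eq_sub (a : ℤ) (z : ℝ) (SM SN : Finset ℕ) {S₁ S₂ : ℕ} (h1 : 1 ≤ S₁) (h : S₁ ≤ S₂ + 1)
    (r l : ℕ) :
    setQSum a z SM SN (Icc S₁ S₂) r l =
      setQSum a z SM SN (Icc 1 S₂) r l - setQSum a z SM SN (Icc 1 (S₁ - 1)) r l := by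
  have hsplit : Icc 1 S₂ = Icc 1 (S₁ - 1) ∪ Icc S₁ S₂ := by
    ext i; simp only [Finset.mem_union, Finset.mem_Icc]; omega
  have hdisj : Disjoint (Icc 1 (S₁ - 1)) (Icc S₁ S₂) := by
    rw [Finset.disjoint_left]; intro i h1' h2'
    simp only [Finset.mem_Icc] at h1' h2'; omega
  rw [hsplit, setQSum_union_Q a z SM SN hdisj]; ring

/-- The four corner terms of `Δ*` over initial ranges attached to a cell `(m₁, m₂] × (n₁, n₂]` and an
`s'`-endpoint `S`. [folklore] -/
def corners4 (a : ℤ) (z : ℝ) (m₁ m₂ n₁ n₂ S r l : ℕ) : ℝ :=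
  |setQSum a z (Icc 1 m₂) (Icc 1 n₂) (Icc 1 S) r l| + |setQSum a z (Icc 1 m₁) (Icc 1 n₂) (Icc 1 S) r l| +
    |setQSum a z (Icc 1 m₂) (Icc 1 n₁) (Icc 1 S) r l| + |setQSum a z (Icc 1 m₁) (Icc 1 n₁) (Icc 1 S) r l|

/-- `corners4 ≥ 0`. [folklore] -/
theorem corners4_nonneg (a : ℤ) (z : ℝ) (m₁ m₂ n₁ n₂ S r l : ℕ) : 0 ≤ corners4 a z m₁ m₂ n₁ n₂ S r l := by
  unfold corners4; positivity

/-- **The inside part of one cell is at most `8` terms of `Δ*` over initial ranges.**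
[cite: BombieriFriedlanderIwaniecActa1986, §13 p. 241–242] -/
theorem abs_setQSum_cell_le (a : ℤ) (z : ℝ) {m₁ m₂ n₁ n₂ : ℕ} (hm : m₁ ≤ m₂) (hn : n₁ ≤ n₂) {S₁ S₂ : ℕ}
    (h1 : 1 ≤ S₁) (h : S₁ ≤ S₂ + 1) (r l : ℕ) :
    |setQSum a z (Ioc m₁ m₂) (Ioc n₁ n₂) (Icc S₁ S₂) r l| ≤
      corners4 a z m₁ m₂ n₁ n₂ S₂ r l + corners4 a z m₁ m₂ n₁ n₂ (S₁ - 1) r l := by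
  rw [setQSum_Icc_eq_sub a z _ _ h1 h]
  have t := abs_sub (setQSum a z (Ioc m₁ m₂) (Ioc n₁ n₂) (Icc 1 S₂) r l)
    (setQSum a z (Ioc m₁ m₂) (Ioc n₁ n₂) (Icc 1 (S₁ - 1)) r l)
  have c1 := abs_setQSum_Ioc_Ioc_le a z hm hn (Icc 1 S₂) r l
  have c2 := abs_setQSum_Ioc_Ioc_le a z hm hn (Icc 1 (S₁ - 1)) r l
  unfold corners4
  linarith

/-! ### One cell: inside, ambiguous and outside ranges of `s'` -/

/-- **Decomposition of the `s'`-sum over one cell.**  Suppose that on the cell `SM × SN` the window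
holds for all `s' ∈ [S₁, S₂]` and fails for all `s' < S_lo` and all `s' > S_hi`
(`1 ≤ S_lo ≤ S₁`, `S₂ ≤ S_max`).  Then the filtered `s'`-sum of `gcount − gmodel` over
`s' ≤ S_max` is the inside window of `setQSum` plus the contribution of the two ambiguous ranges,
which is at most `∑_{s' ambiguous} (gcount + gmodel)`. [cite: BombieriFriedlanderIwaniecActa1986, §13 p. 241–242] -/
theorem abs_sum_cell_le (a : ℤ) (z : ℝ) (SM SN : Finset ℕ) {lc L₀ R : ℕ}
    (haR : Nat.Coprime a.natAbs R) (hlR : lc.Coprime R) (lo hi : ℕ → ℤ) {Smax S₁ S₂ Slo Shi : ℕ}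
    (h1 : 1 ≤ Slo) (hlo : Slo ≤ S₁) (hS2 : S₂ ≤ Smax)
    (hin : ∀ s' ∈ Icc S₁ S₂, ∀ m ∈ SM, ∀ n ∈ SN,
      lo s' < ((L₀ * m * n : ℕ) : ℤ) ∧ ((L₀ * m * n : ℕ) : ℤ) ≤ hi s')
    (hout : ∀ s' : ℕ, (s' < Slo ∨ Shi < s') → ∀ m ∈ SM, ∀ n ∈ SN,
      ¬ (lo s' < ((L₀ * m * n : ℕ) : ℤ) ∧ ((L₀ * m * n : ℕ) : ℤ) ≤ hi s')) :
    |∑ s' ∈ (Icc 1 Smax).filter (fun s' : ℕ => IsCoprime (s' : ℤ) (a * lc)),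
        (gcount a z SM SN lc L₀ (R * s') (lo s') (hi s') - gmodel a z SM SN lc L₀ (R * s') (lo s') (hi s'))| ≤
      |setQSum a z SM SN (Icc S₁ S₂) R lc| +
        ∑ s' ∈ (Icc 1 Smax).filter (fun s' : ℕ => s' ∈ Icc Slo (S₁ - 1) ∨ s' ∈ Ioc S₂ Shi),
          (gcount a z SM SN lc L₀ (R * s') (lo s') (hi s') + gmodel a z SM SN lc L₀ (R * s') (lo s') (hi s')) := by
  set X := (Icc 1 Smax).filter (fun s' : ℕ => IsCoprime (s' : ℤ) (a * lc)) with hX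
  set T : ℕ → ℝ := fun s' =>
    gcount a z SM SN lc L₀ (R * s') (lo s') (hi s') - gmodel a z SM SN lc L₀ (R * s') (lo s') (hi s') with hT
  set Pin : ℕ → Prop := fun s' => s' ∈ Icc S₁ S₂ with hPin
  set Pamb : ℕ → Prop := fun s' => s' ∈ Icc Slo (S₁ - 1) ∨ s' ∈ Ioc S₂ Shi with hPamb
  -- split `X` into inside / not inside, and the latter into ambiguous / outside
  have hsplit1 : ∑ s' ∈ X, T s' = ∑ s' ∈ X.filter Pin, T s' + ∑ s' ∈ X.filter (fun s' => ¬ Pin s'), T s' :=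
    (Finset.sum_filter_add_sum_filter_not X Pin T).symm
  have hsplit2 : ∑ s' ∈ X.filter (fun s' => ¬ Pin s'), T s' =
      ∑ s' ∈ (X.filter (fun s' => ¬ Pin s')).filter Pamb, T s' +
        ∑ s' ∈ (X.filter (fun s' => ¬ Pin s')).filter (fun s' => ¬ Pamb s'), T s' :=
    (Finset.sum_filter_add_sum_filter_not _ Pamb T).symm
  -- outside: every term vanishes
  have hout0 : ∑ s' ∈ (X.filter (fun s' => ¬ Pin s')).filter (fun s' => ¬ Pamb s'), T s' = 0 := by
    refine Finset.sum_eq_zero fun s' hs' => ?_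
    simp only [Finset.mem_filter, hX, hPin, hPamb, Finset.mem_Icc, Finset.mem_Ioc] at hs'
    obtain ⟨⟨⟨⟨hs1, -⟩, -⟩, hnin⟩, hnamb⟩ := hs'
    have hrange : s' < Slo ∨ Shi < s' := by omega
    simp only [hT]
    rw [gcount_eq_zero_of_window a z lc (R * s') (hout s' hrange),
      gmodel_eq_zero_of_window a z lc (R * s') (hout s' hrange), sub_zero]
  -- inside: the filter is `(Icc S₁ S₂).filter`
  have hinset : X.filter Pin = (Icc S₁ S₂).filter (fun s' : ℕ => IsCoprime (s' : ℤ) (a * lc)) := by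
    ext s'
    simp only [hX, hPin, Finset.mem_filter, Finset.mem_Icc]
    constructor
    · rintro ⟨⟨-, hc⟩, hI⟩; exact ⟨hI, hc⟩
    · rintro ⟨hI, hc⟩; exact ⟨⟨⟨by omega, by omega⟩, hc⟩, hI⟩
  have hinside : ∑ s' ∈ X.filter Pin, T s' = setQSum a z SM SN (Icc S₁ S₂) R lc := by
    rw [hinset]
    exact sum_filter_sub_eq_setQSum a z SM SN haR hlR lo hi hin
  -- ambiguous: bound by the nonnegative terms
  have hamb : |∑ s' ∈ (X.filter (fun s' => ¬ Pin s')).filter Pamb, T s'| ≤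
      ∑ s' ∈ (Icc 1 Smax).filter Pamb,
        (gcount a z SM SN lc L₀ (R * s') (lo s') (hi s') + gmodel a z SM SN lc L₀ (R * s') (lo s') (hi s')) := by
    refine (Finset.abs_sum_le_sum_abs _ _).trans ?_
    have hsub : (X.filter (fun s' => ¬ Pin s')).filter Pamb ⊆ (Icc 1 Smax).filter Pamb := by
      intro s' hs'
      simp only [Finset.mem_filter, hX] at hs' ⊢
      exact ⟨hs'.1.1.1, hs'.2⟩
    refine (Finset.sum_le_sum fun s' _ => ?_).trans
      (Finset.sum_le_sum_of_subset_of_nonneg hsub fun s' _ _ =>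
        add_nonneg (gcount_nonneg _ _ _ _ _ _ _ _ _) (gmodel_nonneg _ _ _ _ _ _ _ _ _))
    simp only [hT]
    have h0 := gcount_nonneg a z SM SN lc L₀ (R * s') (lo s') (hi s')
    have h0' := gmodel_nonneg a z SM SN lc L₀ (R * s') (lo s') (hi s')
    rw [abs_le]; constructor <;> linarith
  rw [hsplit1, hsplit2, hout0, add_zero, hinside]
  exact (abs_add_le _ _).trans (by linarith)

/-! ### Breakpoints of a product cell -/

/-- `⌈x/y⌉ · y ≥ x` for the natural ceiling `(x + y − 1)/y`. [folklore] -/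
theorem le_ceilDiv_mul {x y : ℕ} (hy : 0 < y) : x ≤ (x + y - 1) / y * y := by
  have := Nat.lt_div_mul_add (a := x + y - 1) hy
  omega

/-- `(⌈x/y⌉ − 1) · y < x` for `x ≥ 1`. [folklore] -/
theorem ceilDiv_pred_mul_lt {x y : ℕ} (hx : 0 < x) (hy : 0 < y) : ((x + y - 1) / y - 1) * y < x := by
  have h1 : (x + y - 1) / y * y ≤ x + y - 1 := Nat.div_mul_le_self _ _
  have h2 : 1 ≤ (x + y - 1) / y := by
    rw [Nat.le_div_iff_mul_le hy]; omega
  have : ((x + y - 1) / y - 1) * y = (x + y - 1) / y * y - y := by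
    rw [Nat.sub_mul, one_mul]
  rw [this]
  have : y ≤ (x + y - 1) / y * y := by nlinarith
  omega

/-- **The window holds on the inside range.**  For `K ∈ [K₋, K₊]`, `D ∈ [D₋, D₊]` (`D₋ ≥ 1`) and
`⌈K₊/(2D₋)⌉ ≤ s' ≤ (K₋ − 1)/D₊`: `D s' < K ≤ 2 D s'`. [folklore] -/
theorem window_of_mem_inside {Km Kp Dm Dp K D s' : ℕ} (hK : Km ≤ K ∧ K ≤ Kp) (hD : Dm ≤ D ∧ D ≤ Dp)
    (hDm : 0 < Dm) (hKm : 0 < Km) (hs : (Kp + 2 * Dm - 1) / (2 * Dm) ≤ s' ∧ s' ≤ (Km - 1) / Dp) :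
    D * s' < K ∧ K ≤ 2 * D * s' := by
  constructor
  · have h1 : Dp * ((Km - 1) / Dp) ≤ Km - 1 := Nat.mul_div_le _ _
    have h2 : D * s' ≤ Dp * ((Km - 1) / Dp) := Nat.mul_le_mul hD.2 hs.2
    omega
  · have h1 : Kp ≤ (Kp + 2 * Dm - 1) / (2 * Dm) * (2 * Dm) := le_ceilDiv_mul (by omega)
    have h2 : (Kp + 2 * Dm - 1) / (2 * Dm) * (2 * Dm) ≤ s' * (2 * D) :=
      Nat.mul_le_mul hs.1 (by omega)
    nlinarith

/-- **The window fails outside `[⌈K₋/(2D₊)⌉, (K₊ − 1)/D₋]`.** [folklore] -/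
theorem not_window_of_outside {Km Kp Dm Dp K D s' : ℕ} (hK : Km ≤ K ∧ K ≤ Kp) (hD : Dm ≤ D ∧ D ≤ Dp)
    (hDm : 0 < Dm) (hKm : 0 < Km)
    (hs : s' < (Km + 2 * Dp - 1) / (2 * Dp) ∨ (Kp - 1) / Dm < s') :
    ¬ (D * s' < K ∧ K ≤ 2 * D * s') := by
  rintro ⟨hl, hr⟩
  rcases hs with hs | hs
  · -- `2 D s' ≤ 2 Dp s' < Km ≤ K`
    have hDp : 0 < Dp := by omega
    have h1 : s' ≤ (Km + 2 * Dp - 1) / (2 * Dp) - 1 := by omega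
    have h2 : ((Km + 2 * Dp - 1) / (2 * Dp) - 1) * (2 * Dp) < Km := ceilDiv_pred_mul_lt hKm (by omega)
    have h3 : s' * (2 * Dp) < Km := lt_of_le_of_lt (Nat.mul_le_mul_right _ h1) h2
    nlinarith
  · -- `D s' ≥ Dm s' ≥ Dm ((Kp−1)/Dm + 1) > Kp − 1`
    have h1 : (Kp - 1) / Dm + 1 ≤ s' := hs
    have h2 : Kp - 1 < ((Kp - 1) / Dm + 1) * Dm := by
      have := Nat.lt_div_mul_add (a := Kp - 1) hDm
      nlinarith
    have h3 : ((Kp - 1) / Dm + 1) * Dm ≤ s' * D := Nat.mul_le_mul h1 hD.1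
    have h4 : D * s' = s' * D := mul_comm _ _
    omega

/-- The breakpoints are ordered: `1 ≤ ⌈K₋/(2D₊)⌉ ≤ ⌈K₊/(2D₋)⌉` and `(K₋−1)/D₊ ≤ (K₊−1)/D₋`. [folklore] -/
theorem breakpoints_ordered {Km Kp Dm Dp : ℕ} (hK : Km ≤ Kp) (hD : Dm ≤ Dp) (hDm : 0 < Dm) (hKm : 0 < Km) :
    1 ≤ (Km + 2 * Dp - 1) / (2 * Dp) ∧
      (Km + 2 * Dp - 1) / (2 * Dp) ≤ (Kp + 2 * Dm - 1) / (2 * Dm) ∧ (Km - 1) / Dp ≤ (Kp - 1) / Dm := by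
  have hDp : 0 < Dp := by omega
  refine ⟨?_, ?_, ?_⟩
  · rw [Nat.le_div_iff_mul_le (by omega)]; omega
  · -- `⌈Km/(2Dp)⌉ ≤ ⌈Kp/(2Dm)⌉`: compare via the defining inequalities
    rw [Nat.le_div_iff_mul_le (by omega)]
    -- `⌈Km/(2Dp)⌉ * (2 Dm) ≤ Kp + 2 Dm - 1` follows from `(⌈Km/(2Dp)⌉ - 1) * (2 Dp) < Km`
    have h1 := ceilDiv_pred_mul_lt (x := Km) (y := 2 * Dp) hKm (by omega)
    set c := (Km + 2 * Dp - 1) / (2 * Dp) with hc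
    have hc1 : 1 ≤ c := by rw [hc, Nat.le_div_iff_mul_le (by omega)]; omega
    have h2 : (c - 1) * (2 * Dm) ≤ (c - 1) * (2 * Dp) := Nat.mul_le_mul_left _ (by omega)
    have h3 : (c - 1) * (2 * Dm) < Kp := by omega
    have h4 : c * (2 * Dm) = (c - 1) * (2 * Dm) + 2 * Dm := by
      rw [Nat.sub_mul]; have : 2 * Dm ≤ c * (2 * Dm) := by nlinarith
      omega
    omega
  · calc (Km - 1) / Dp ≤ (Kp - 1) / Dp := Nat.div_le_div_right (by omega)
      _ ≤ (Kp - 1) / Dm := Nat.div_le_div_left hD hDm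

/-! ### Valuations of the grouping modulus `Θ_d` and of the reduction constants -/

/-- `v_q(∏_{p ∈ U} p^{f p}) = f q · [q ∈ U]` for a set `U` of primes and a prime `q`. [folklore] -/
theorem padicValNat_prod_pow {U : Finset ℕ} (hU : ∀ p ∈ U, p.Prime) (f : ℕ → ℕ) {q : ℕ} (hq : q.Prime) :
    padicValNat q (∏ p ∈ U, p ^ f p) = if q ∈ U then f q else 0 := by
  classical
  haveI := Fact.mk hq
  induction U using Finset.induction_on with
  | empty => simp
  | insert p U hpU ih =>
    have hp : p.Prime := hU p (Finset.mem_insert_self p U)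
    have hU' : ∀ x ∈ U, x.Prime := fun x hx => hU x (Finset.mem_insert_of_mem hx)
    have hprod : ∏ x ∈ U, x ^ f x ≠ 0 :=
      Finset.prod_ne_zero_iff.2 fun x hx => pow_ne_zero _ (hU' x hx).ne_zero
    rw [Finset.prod_insert hpU, padicValNat.mul (pow_ne_zero _ hp.ne_zero) hprod, ih hU',
      padicValNat.pow]
    have hmem : q ∈ insert p U ↔ q = p ∨ q ∈ U := Finset.mem_insert
    by_cases hqp : q = p
    · subst hqp
      rw [padicValNat.self hq.one_lt, if_neg hpU, if_pos (Finset.mem_insert_self q U)]; ring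
    · haveI := Fact.mk hp
      rw [padicValNat_primes hqp]
      by_cases hqU : q ∈ U
      · rw [if_pos hqU, if_pos (Finset.mem_insert_of_mem hqU)]; ring
      · rw [if_neg hqU, if_neg (fun h => by rw [hmem] at h; tauto)]; ring

/-- The prime support of such a product. [folklore] -/
theorem prime_dvd_prod_pow_iff {U : Finset ℕ} (hU : ∀ p ∈ U, p.Prime) (f : ℕ → ℕ) {q : ℕ} (hq : q.Prime) :
    q ∣ ∏ p ∈ U, p ^ f p ↔ q ∈ U ∧ 0 < f q := by
  haveI := Fact.mk hq
  have hprod : ∏ x ∈ U, x ^ f x ≠ 0 :=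
    Finset.prod_ne_zero_iff.2 fun x hx => pow_ne_zero _ (hU x hx).ne_zero
  rw [dvd_iff_padicValNat_ne_zero hprod, padicValNat_prod_pow hU f hq]
  split_ifs with h
  · simp [h, Nat.pos_iff_ne_zero]
  · simp [h]

/-- The grouping modulus for the `s`-variable at the Möbius divisor `d`:
`Θ_d = ∏_{p ∣ a} p^{v_p(a) + 1 − v_p(d)}`. [folklore] -/
def ThetaD (A d : ℕ) : ℕ := ∏ p ∈ A.primeFactors, p ^ (padicValNat p A + 1 - padicValNat p d)

/-- `Θ_d > 0`. [folklore] -/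
theorem ThetaD_pos (A d : ℕ) : 0 < ThetaD A d :=
  Finset.prod_pos fun _ hp => pow_pos (Nat.prime_of_mem_primeFactors hp).pos _

/-- `v_q(Θ_d)`. [folklore] -/
theorem padicValNat_ThetaD (A d : ℕ) {q : ℕ} (hq : q.Prime) :
    padicValNat q (ThetaD A d) = if q ∈ A.primeFactors then padicValNat q A + 1 - padicValNat q d else 0 :=
  padicValNat_prod_pow (fun _ hp => Nat.prime_of_mem_primeFactors hp) _ hq

/-- For `d ∣ A`, `g ∣ Θ_d` and a prime `q`: `v_q(d g) ≤ v_q(A) + 1` at the primes of `A`. [folklore] -/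
theorem padicValNat_mul_le_of_dvd_ThetaD {A d g : ℕ} (hA : A ≠ 0) (hd : d ∣ A) (hg : g ∣ ThetaD A d)
    {q : ℕ} (hq : q.Prime) : padicValNat q (d * g) ≤ padicValNat q A + 1 := by
  haveI := Fact.mk hq
  have hd0 : d ≠ 0 := fun h => hA (by rw [h, zero_dvd_iff] at hd; exact hd)
  have hg0 : g ≠ 0 := fun h => (ThetaD_pos A d).ne' (by rw [h, zero_dvd_iff] at hg; exact hg)
  have hvg : padicValNat q g ≤ padicValNat q (ThetaD A d) :=
    (padicValNat_dvd_iff_le (ThetaD_pos A d).ne').1 (pow_padicValNat_dvd.trans hg)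
  have hvd : padicValNat q d ≤ padicValNat q A :=
    (padicValNat_dvd_iff_le hA).1 (pow_padicValNat_dvd.trans hd)
  rw [padicValNat.mul hd0 hg0, padicValNat_ThetaD A d hq] at *
  split_ifs at hvg with h
  · omega
  · have : padicValNat q A = 0 := by
      rw [padicValNat.eq_zero_iff]; right; right
      intro hqA; exact h (Nat.mem_primeFactors.2 ⟨hq, hqA, hA⟩)
    omega

/-- **The primes of `Θ_d / g` are the `G`-primes**: for `d ∣ A`, `g ∣ Θ_d`, a prime `q` divides
`Θ_d/g` iff `q ∣ A` and `v_q(dg) ≤ v_q(A)`. [folklore] -/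
theorem prime_dvd_ThetaD_div_iff {A d g : ℕ} (hA : A ≠ 0) (hd : d ∣ A) (hg : g ∣ ThetaD A d)
    {q : ℕ} (hq : q.Prime) :
    q ∣ ThetaD A d / g ↔ q ∈ A.primeFactors ∧ padicValNat q (d * g) ≤ padicValNat q A := by
  haveI := Fact.mk hq
  have hd0 : d ≠ 0 := fun h => hA (by rw [h, zero_dvd_iff] at hd; exact hd)
  have hΘ0 : ThetaD A d ≠ 0 := (ThetaD_pos A d).ne'
  have hg0 : g ≠ 0 := fun h => hΘ0 (by rw [h, zero_dvd_iff] at hg; exact hg)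
  have hq0 : ThetaD A d / g ≠ 0 := (Nat.div_pos (Nat.le_of_dvd (ThetaD_pos A d) hg) (Nat.pos_of_ne_zero hg0)).ne'
  have hvg : padicValNat q g ≤ padicValNat q (ThetaD A d) :=
    (padicValNat_dvd_iff_le hΘ0).1 (pow_padicValNat_dvd.trans hg)
  have hvd : padicValNat q d ≤ padicValNat q A :=
    (padicValNat_dvd_iff_le hA).1 (pow_padicValNat_dvd.trans hd)
  rw [dvd_iff_padicValNat_ne_zero hq0, padicValNat.div_of_dvd hg, padicValNat.mul hd0 hg0]
  rw [padicValNat_ThetaD A d hq] at hvg ⊢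
  split_ifs at hvg ⊢ with h
  · simp only [h, true_and]; omega
  · simp only [h, false_and, iff_false, not_not]; omega

/-- `v_q(E) = v_q(a) · [q ∈ U]` for the reduction constant `E = ∏_{p ∈ U} p^{v_p(a)}`. [folklore] -/
theorem padicValNat_Ered {ps : List ℕ} (hpr : ∀ p ∈ ps, p.Prime) (a : ℤ) (e : ℕ) {q : ℕ} (hq : q.Prime) :
    padicValNat q (Ered ps a e) = if q ∈ Uset ps a e then padicValNat q a.natAbs else 0 := by
  unfold Ered
  exact padicValNat_prod_pow (fun p hp => hpr p (List.mem_toFinset.1 (Uset_subset ps a e hp))) _ hq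

/-- `E ∣ |a|`. [folklore] -/
theorem Ered_dvd {ps : List ℕ} (hpr : ∀ p ∈ ps, p.Prime) {a : ℤ} (ha : a ≠ 0) (e : ℕ) :
    Ered ps a e ∣ a.natAbs := by
  have hA : a.natAbs ≠ 0 := Int.natAbs_ne_zero.2 ha
  have hE : Ered ps a e ≠ 0 := (Ered_pos hpr a e).ne'
  rw [← Nat.factorization_le_iff_dvd hE hA, Finsupp.le_def]
  intro q
  by_cases hq : q.Prime
  · rw [Nat.factorization_def _ hq, Nat.factorization_def _ hq, padicValNat_Ered hpr a e hq]
    split_ifs <;> omega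
  · simp [Nat.factorization_eq_zero_of_not_prime _ hq]

/-- **The primes of `ã = a/E` are the `G`-primes**: with `ps` the primes of `a` and `e = dg`,
a prime `q` divides `a / E` iff `q ∣ a` and `q ∉ U`, i.e. iff `q ∣ a` and `v_q(dg) ≠ v_q(a) + 1`.
[folklore] -/
theorem prime_dvd_div_Ered_iff {a : ℤ} (ha : a ≠ 0) (e : ℕ) {q : ℕ} (hq : q.Prime) :
    (q : ℤ) ∣ a / (Ered (a.natAbs.primeFactors.sort (· ≤ ·)) a e : ℤ) ↔
      q ∈ a.natAbs.primeFactors ∧ padicValNat q e ≠ padicValNat q a.natAbs + 1 := by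
  haveI := Fact.mk hq
  set ps := a.natAbs.primeFactors.sort (· ≤ ·) with hps
  have hpr : ∀ p ∈ ps, p.Prime := fun p hp =>
    Nat.prime_of_mem_primeFactors ((Finset.mem_sort _).1 hp)
  have hA : a.natAbs ≠ 0 := Int.natAbs_ne_zero.2 ha
  set E := Ered ps a e with hE
  have hE0 : E ≠ 0 := (Ered_pos hpr a e).ne'
  have hEdvd : E ∣ a.natAbs := Ered_dvd hpr ha e
  have hEdvd' : (E : ℤ) ∣ a := Int.natCast_dvd.2 hEdvd
  have hnat : (a / (E : ℤ)).natAbs = a.natAbs / E := by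
    rw [Int.natAbs_ediv_of_dvd hEdvd', Int.natAbs_natCast]
  have hq0 : a.natAbs / E ≠ 0 := (Nat.div_pos (Nat.le_of_dvd (Nat.pos_of_ne_zero hA) hEdvd) (Nat.pos_of_ne_zero hE0)).ne'
  rw [Int.natCast_dvd, hnat, dvd_iff_padicValNat_ne_zero hq0, padicValNat.div_of_dvd hEdvd,
    padicValNat_Ered hpr a e hq]
  have hUiff : q ∈ Uset ps a e ↔ q ∈ a.natAbs.primeFactors ∧ padicValNat q e = padicValNat q a.natAbs + 1 := by
    unfold Uset
    rw [Finset.mem_filter, hps]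
    simp only [List.mem_toFinset, Finset.mem_sort]
  by_cases hqA : q ∈ a.natAbs.primeFactors
  · have hvA : 0 < padicValNat q a.natAbs :=
      one_le_padicValNat_of_dvd hA (Nat.dvd_of_mem_primeFactors hqA)
    by_cases hU : q ∈ Uset ps a e
    · rw [if_pos hU]
      have := (hUiff.1 hU).2
      simp only [hqA, true_and, ne_eq, this, not_true_eq_false, iff_false, not_not]
      omega
    · rw [if_neg hU]
      have hne : padicValNat q e ≠ padicValNat q a.natAbs + 1 := fun h => hU (hUiff.2 ⟨hqA, h⟩)
      simp only [hqA, true_and, ne_eq, hne, not_false_eq_true, iff_true]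
      omega
  · have hvA : padicValNat q a.natAbs = 0 := by
      rw [padicValNat.eq_zero_iff]; right; right
      intro h; exact hqA (Nat.mem_primeFactors.2 ⟨hq, h, hA⟩)
    simp only [hqA, false_and, iff_false, ne_eq, not_not]
    split_ifs <;> omega

/-- **The grouping filter is the filter of `Δ*`**: with `ps` the primes of `a`, `e = dg`, `d ∣ |a|`,
`g ∣ Θ_d`, for every `s'`: `(s', Θ_d/g) = 1 ⇔ (s', a/E) = 1`. [folklore] -/
theorem coprime_ThetaD_div_iff {a : ℤ} (ha : a ≠ 0) {d g : ℕ} (hd : d ∣ a.natAbs) (hg : g ∣ ThetaD a.natAbs d)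
    (s' : ℕ) :
    s'.Coprime (ThetaD a.natAbs d / g) ↔
      IsCoprime (s' : ℤ) (a / (Ered (a.natAbs.primeFactors.sort (· ≤ ·)) a (d * g) : ℤ)) := by
  have hA : a.natAbs ≠ 0 := Int.natAbs_ne_zero.2 ha
  rw [Int.isCoprime_iff_gcd_eq_one, Int.gcd_eq_natAbs, Int.natAbs_natCast, ← Nat.coprime_iff_gcd_eq_one]
  -- both sides: no prime divides `s'` and the other number
  rw [← not_iff_not, Nat.Prime.not_coprime_iff_dvd, Nat.Prime.not_coprime_iff_dvd]
  constructor
  · rintro ⟨q, hq, hqs, hqΘ⟩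
    refine ⟨q, hq, hqs, ?_⟩
    have h := (prime_dvd_ThetaD_div_iff hA hd hg hq).1 hqΘ
    have h' : (q : ℤ) ∣ a / (Ered (a.natAbs.primeFactors.sort (· ≤ ·)) a (d * g) : ℤ) := by
      rw [prime_dvd_div_Ered_iff ha (d * g) hq]
      exact ⟨h.1, by omega⟩
    exact Int.natCast_dvd.1 h'
  · rintro ⟨q, hq, hqs, hqa⟩
    refine ⟨q, hq, hqs, ?_⟩
    have h' : (q : ℤ) ∣ a / (Ered (a.natAbs.primeFactors.sort (· ≤ ·)) a (d * g) : ℤ) :=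
      Int.natCast_dvd.2 hqa
    rw [prime_dvd_div_Ered_iff ha (d * g) hq] at h'
    rw [prime_dvd_ThetaD_div_iff hA hd hg hq]
    have := padicValNat_mul_le_of_dvd_ThetaD hA hd hg hq
    exact ⟨h'.1, by omega⟩

/-! ### The reduction data attached to `a` -/

/-- The sorted list of the primes of `a`. [folklore] -/
def psA (a : ℤ) : List ℕ := a.natAbs.primeFactors.sort (· ≤ ·)

/-- `psA a` has no duplicates. [folklore] -/
theorem psA_nodup (a : ℤ) : (psA a).Nodup := Finset.sort_nodup _ _

/-- Membership in `psA a`. [folklore] -/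
theorem mem_psA {a : ℤ} {p : ℕ} : p ∈ psA a ↔ p ∈ a.natAbs.primeFactors := by
  unfold psA; rw [Finset.mem_sort]

/-- The elements of `psA a` are primes. [folklore] -/
theorem prime_of_mem_psA {a : ℤ} {p : ℕ} (hp : p ∈ psA a) : p.Prime :=
  Nat.prime_of_mem_primeFactors (mem_psA.1 hp)

/-- The capped `p`-adic profile of `l` at the primes of `a` (the data the reduction of `…SwitchPadic`
depends on), extended by `0` to all other `p` (so that the profile takes at most `∏_{p ∣ a} (v_p(a) + 2)`
values as a function). [folklore] -/
def profOf (a : ℤ) (l : ℕ) : ℕ → ℕ := fun p =>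
  if p ∈ a.natAbs.primeFactors then min (padicValNat p l) (padicValNat p a.natAbs + 1) else 0

/-- On the primes of `a`, `profOf` is the capped valuation. [folklore] -/
theorem profOf_apply_of_mem {a : ℤ} {l p : ℕ} (hp : p ∈ psA a) :
    min (padicValNat p l) (padicValNat p a.natAbs + 1) = profOf a l p := by
  unfold profOf; rw [if_pos (mem_psA.1 hp)]

/-- The hypotheses of `BFI.padic_reduction` for `e = d g`, `d ∣ |a|`, `g ∣ Θ_d`. [folklore] -/
theorem red_hyps {a : ℤ} (ha : a ≠ 0) {d g : ℕ} (hd : d ∣ a.natAbs) (hg : g ∣ ThetaD a.natAbs d) :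
    0 < d * g ∧ (∀ q : ℕ, q.Prime → q ∣ d * g → q ∈ psA a) ∧
      (∀ p ∈ psA a, padicValNat p (d * g) ≤ padicValNat p a.natAbs + 1) := by
  have hA : a.natAbs ≠ 0 := Int.natAbs_ne_zero.2 ha
  have hd0 : 0 < d := Nat.pos_of_ne_zero fun h => hA (by rw [h, zero_dvd_iff] at hd; exact hd)
  have hg0 : 0 < g := Nat.pos_of_ne_zero fun h =>
    (ThetaD_pos a.natAbs d).ne' (by rw [h, zero_dvd_iff] at hg; exact hg)
  refine ⟨Nat.mul_pos hd0 hg0, ?_, fun p hp => padicValNat_mul_le_of_dvd_ThetaD hA hd hg (prime_of_mem_psA hp)⟩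
  intro q hq hqdg
  rw [mem_psA, Nat.mem_primeFactors]
  refine ⟨hq, ?_, hA⟩
  rcases (Nat.Prime.dvd_mul hq).1 hqdg with h | h
  · exact h.trans hd
  · -- `q ∣ g ∣ Θ_d`, whose primes divide `A`
    have hqΘ : q ∣ ThetaD a.natAbs d := h.trans hg
    unfold ThetaD at hqΘ
    rw [prime_dvd_prod_pow_iff (fun _ hp => Nat.prime_of_mem_primeFactors hp) _ hq] at hqΘ
    exact Nat.dvd_of_mem_primeFactors hqΘ.1

/-- The list of reduction terms for `(d, g)` and a profile (empty off the admissible range). [folklore] -/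
def Tsel (a : ℤ) (d g : ℕ) (prof : ℕ → ℕ) : List (ℤ × ℕ × ℕ) :=
  if h : a ≠ 0 ∧ d ∣ a.natAbs ∧ g ∣ ThetaD a.natAbs d then
    Classical.choose (padic_reduction (psA a) (psA_nodup a) (fun _ hp => prime_of_mem_psA hp) a h.1 (d * g)
      (red_hyps h.1 h.2.1 h.2.2).1 (red_hyps h.1 h.2.1 h.2.2).2.1 (red_hyps h.1 h.2.1 h.2.2).2.2 prof)
  else []

/-- The defining property of `Tsel`. [folklore] -/
theorem Tsel_spec {a : ℤ} (ha : a ≠ 0) {d g : ℕ} (hd : d ∣ a.natAbs) (hg : g ∣ ThetaD a.natAbs d)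
    (prof : ℕ → ℕ) : RedProp (psA a) a (d * g) prof (Tsel a d g prof) := by
  unfold Tsel
  rw [dif_pos ⟨ha, hd, hg⟩]
  exact Classical.choose_spec (padic_reduction (psA a) (psA_nodup a) (fun _ hp => prime_of_mem_psA hp) a ha
    (d * g) (red_hyps ha hd hg).1 (red_hyps ha hd hg).2.1 (red_hyps ha hd hg).2.2 prof)

/-- The reduction constant `E` for `(a, dg)`. [folklore] -/
def Ea (a : ℤ) (d g : ℕ) : ℕ := Ered (psA a) a (d * g)

/-- The reduction constant `P` for `(a, dg)`. [folklore] -/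
def Pa (a : ℤ) (d g : ℕ) : ℕ := Pred (psA a) a (d * g)

/-- `E > 0`. [folklore] -/
theorem Ea_pos (a : ℤ) (d g : ℕ) : 0 < Ea a d g := Ered_pos (fun _ hp => prime_of_mem_psA hp) a _

/-- `P > 0`. [folklore] -/
theorem Pa_pos (a : ℤ) (d g : ℕ) : 0 < Pa a d g := Pred_pos (fun _ hp => prime_of_mem_psA hp) a _

/-! ### Small list helpers -/

/-- Swapping a finite sum with a list sum. [folklore] -/
theorem sum_list_map_swap {β : Type*} (T : List β) (f : β → ℕ → ℝ) (s : Finset ℕ) :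
    ∑ x ∈ s, (T.map (fun t => f t x)).sum = (T.map (fun t => ∑ x ∈ s, f t x)).sum := by
  induction T with
  | nil => simp
  | cons t T ih => simp [Finset.sum_add_distrib, ih]

/-- `|∑_T c_t y_t| ≤ ∑_T |y_t|` when `|c_t| ≤ 1`. [folklore] -/
theorem abs_list_sum_le {β : Type*} (T : List β) (c y : β → ℝ) (hc : ∀ t ∈ T, |c t| ≤ 1) :
    |(T.map (fun t => c t * y t)).sum| ≤ (T.map (fun t => |y t|)).sum := by
  induction T with
  | nil => simp
  | cons t T ih =>
    simp only [List.map_cons, List.sum_cons]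
    have h1 : |c t * y t| ≤ |y t| := by
      rw [abs_mul]
      exact (mul_le_mul_of_nonneg_right (hc t (List.mem_cons_self)) (abs_nonneg _)).trans (by rw [one_mul])
    have h2 := ih (fun t' ht' => hc t' (List.mem_cons_of_mem t ht'))
    exact (abs_add_le _ _).trans (add_le_add h1 h2)

/-- `(∑_T f) − (∑_T g) = ∑_T (f − g)` for list sums. [folklore] -/
theorem list_sum_map_sub {β : Type*} (T : List β) (f g : β → ℝ) :
    (T.map f).sum - (T.map g).sum = (T.map (fun t => f t - g t)).sum := by
  induction T with
  | nil => simp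
  | cons t T ih => simp only [List.map_cons, List.sum_cons]; rw [← ih]; ring

/-! ### The reduced `s'`-sums of one `(r, l)` term -/

/-- The reduced `s'`-sum attached to `(r, l)`, the Möbius divisor `d`, the `|a|`-part `g` of `s` and a
reduction term `t = (c, D_m, D_n)`: with `ã = a/E`, `l̃ = l D_m D_n / E`,
`X_t(r,l) = ∑_{s' ≤ S/g, (s', ã l̃) = 1} (gcount − gmodel)(ã, SM/D_m, SN/D_n, l̃, l D_m D_n, P r s', a + Q'r g s', a + 2Q'r g s')`.
[folklore] -/
def Xred (a : ℤ) (z : ℝ) (SM SN : Finset ℕ) (l r Q' S d g : ℕ) (t : ℤ × ℕ × ℕ) : ℝ :=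
  ∑ s' ∈ (Icc 1 (S / g)).filter (fun s' : ℕ =>
      IsCoprime (s' : ℤ) (a / (Ea a d g : ℤ) * (((l * t.2.1 * t.2.2 / Ea a d g : ℕ) : ℤ)))),
    (gcount (a / (Ea a d g : ℤ)) z (sdiv SM t.2.1) (sdiv SN t.2.2) (l * t.2.1 * t.2.2 / Ea a d g)
        (l * t.2.1 * t.2.2) (Pa a d g * (r * s'))
        (a + (Q' : ℤ) * r * ((g * s' : ℕ) : ℤ)) (a + 2 * (Q' : ℤ) * r * ((g * s' : ℕ) : ℤ)) -
      gmodel (a / (Ea a d g : ℤ)) z (sdiv SM t.2.1) (sdiv SN t.2.2) (l * t.2.1 * t.2.2 / Ea a d g)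
        (l * t.2.1 * t.2.2) (Pa a d g * (r * s'))
        (a + (Q' : ℤ) * r * ((g * s' : ℕ) : ℤ)) (a + 2 * (Q' : ℤ) * r * ((g * s' : ℕ) : ℤ)))

/-- **The switched difference of one `(r, l)` term is dominated by the reduced `s'`-sums**:
for `a ≠ 0`, `r ≥ 1` with `(r, a) = 1`, `l ≥ 1`, ranges of positive integers,
`|∑_{d ∣ |a|} μ(d) ∑_{s ≤ S} (gcount − gmodel)(a, SM, SN, l, l, d r s, …)| ≤ ∑_{d ∣ |a|} ∑_{g ∣ Θ_d} ∑_{t ∈ T(d,g,l)} ρ(D_m)ρ(D_n)|X_t(r,l)|`.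
[cite: BombieriFriedlanderIwaniecActa1986, §13 p. 241–242] -/
theorem abs_switch_diff_le_sum_Xred {a : ℤ} (ha : a ≠ 0) (z : ℝ) {SM SN : Finset ℕ}
    (hSM : ∀ m ∈ SM, 0 < m) (hSN : ∀ n ∈ SN, 0 < n) {l r : ℕ} (hl : 0 < l) (hr : 0 < r)
    (hrA : r.Coprime a.natAbs) (Q' S : ℕ) :
    |∑ d ∈ a.natAbs.divisors, (μ d : ℝ) * ∑ s ∈ Icc 1 S,
        (gcount a z SM SN l l (d * (r * s)) (a + (Q' : ℤ) * r * s) (a + 2 * (Q' : ℤ) * r * s) -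
          gmodel a z SM SN l l (d * (r * s)) (a + (Q' : ℤ) * r * s) (a + 2 * (Q' : ℤ) * r * s))| ≤
      ∑ d ∈ a.natAbs.divisors, ∑ g ∈ (ThetaD a.natAbs d).divisors,
        ((Tsel a d g (profOf a l)).map (fun t =>
          roughIndicator z t.2.1 * roughIndicator z t.2.2 * |Xred a z SM SN l r Q' S d g t|)).sum := by
  have hA : a.natAbs ≠ 0 := Int.natAbs_ne_zero.2 ha
  refine (Finset.abs_sum_le_sum_abs _ _).trans (Finset.sum_le_sum fun d hd => ?_)
  have hdA : d ∣ a.natAbs := Nat.dvd_of_mem_divisors hd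
  have hμ : |(μ d : ℝ)| ≤ 1 := by exact_mod_cast ArithmeticFunction.abs_moebius_le_one
  rw [abs_mul]
  refine (mul_le_mul_of_nonneg_right hμ (abs_nonneg _)).trans ?_
  rw [one_mul]
  -- group `s` by `g = (s, Θ_d)`
  set F : ℕ → ℝ := fun s =>
    gcount a z SM SN l l (d * (r * s)) (a + (Q' : ℤ) * r * s) (a + 2 * (Q' : ℤ) * r * s) -
      gmodel a z SM SN l l (d * (r * s)) (a + (Q' : ℤ) * r * s) (a + 2 * (Q' : ℤ) * r * s) with hF
  rw [show (∑ s ∈ Icc 1 S, (gcount a z SM SN l l (d * (r * s)) (a + (Q' : ℤ) * r * s) (a + 2 * (Q' : ℤ) * r * s) -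
      gmodel a z SM SN l l (d * (r * s)) (a + (Q' : ℤ) * r * s) (a + 2 * (Q' : ℤ) * r * s))) =
      ∑ s ∈ Icc 1 S, F s from rfl,
    sum_Icc_eq_sum_divisors_gcd (ThetaD_pos a.natAbs d) S]
  refine (Finset.abs_sum_le_sum_abs _ _).trans (Finset.sum_le_sum fun g hg => ?_)
  have hgΘ : g ∣ ThetaD a.natAbs d := Nat.dvd_of_mem_divisors hg
  have hg0 : 0 < g := Nat.pos_of_mem_divisors hg
  -- the reduction data
  set T := Tsel a d g (profOf a l) with hTdef
  have hspec := Tsel_spec ha hdA hgΘ (profOf a l)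
  obtain ⟨-, hterms, hident⟩ := hspec
  obtain ⟨-, hid⟩ := hident l hl (fun p hp => profOf_apply_of_mem hp)
  have hEa : Ered (psA a) a (d * g) = Ea a d g := rfl
  have hPa : Pred (psA a) a (d * g) = Pa a d g := rfl
  -- apply the identity for each `s'` in the filter
  have hGcond : ∀ s' ∈ (Icc 1 (S / g)).filter (fun s' : ℕ => s'.Coprime (ThetaD a.natAbs d / g)),
      ∀ p ∈ psA a, padicValNat p (d * g) ≤ padicValNat p a.natAbs → ¬ p ∣ r * s' := by
    intro s' hs' p hp hval hdvd
    have hpP : p.Prime := prime_of_mem_psA hp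
    have hpA : p ∈ a.natAbs.primeFactors := mem_psA.1 hp
    rcases (Nat.Prime.dvd_mul hpP).1 hdvd with hpr | hps
    · -- `p ∣ r` contradicts `(r, a) = 1`
      have := Nat.dvd_gcd hpr (Nat.dvd_of_mem_primeFactors hpA)
      rw [hrA] at this
      exact hpP.one_lt.ne' (Nat.dvd_one.1 this)
    · have hpΘ : p ∣ ThetaD a.natAbs d / g := (prime_dvd_ThetaD_div_iff hA hdA hgΘ hpP).2 ⟨hpA, hval⟩
      have hcop := (Finset.mem_filter.1 hs').2
      have := Nat.dvd_gcd hps hpΘ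
      rw [hcop] at this
      exact hpP.one_lt.ne' (Nat.dvd_one.1 this)
  set Y : (ℤ × ℕ × ℕ) → ℕ → ℝ := fun t s' =>
    gcount (a / (Ea a d g : ℤ)) z (sdiv SM t.2.1) (sdiv SN t.2.2) (l * t.2.1 * t.2.2 / Ea a d g) (l * t.2.1 * t.2.2)
        (Pa a d g * (r * s')) (a + (Q' : ℤ) * r * ((g * s' : ℕ) : ℤ)) (a + 2 * (Q' : ℤ) * r * ((g * s' : ℕ) : ℤ)) -
      gmodel (a / (Ea a d g : ℤ)) z (sdiv SM t.2.1) (sdiv SN t.2.2) (l * t.2.1 * t.2.2 / Ea a d g) (l * t.2.1 * t.2.2)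
        (Pa a d g * (r * s')) (a + (Q' : ℤ) * r * ((g * s' : ℕ) : ℤ)) (a + 2 * (Q' : ℤ) * r * ((g * s' : ℕ) : ℤ)) with hY
  have hFeq : ∀ s' ∈ (Icc 1 (S / g)).filter (fun s' : ℕ => s'.Coprime (ThetaD a.natAbs d / g)),
      F (g * s') = (T.map (fun t => (t.1 : ℝ) * (roughIndicator z t.2.1 * roughIndicator z t.2.2) * Y t s')).sum := by
    intro s' hs'
    have hs'1 : 0 < s' := (Finset.mem_Icc.1 (Finset.mem_filter.1 hs').1).1
    obtain ⟨hA', hB'⟩ := hid z SM SN (l) (a + (Q' : ℤ) * r * ((g * s' : ℕ) : ℤ))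
      (a + 2 * (Q' : ℤ) * r * ((g * s' : ℕ) : ℤ)) (r * s') hSM hSN (Nat.mul_pos hr hs'1) (hGcond s' hs')
    rw [hEa, hPa] at hA' hB'
    simp only [hF]
    rw [show d * (r * (g * s')) = d * g * (r * s') by ring, hA', hB', list_sum_map_sub]
    congr 1
    refine List.map_congr_left fun t _ => ?_
    simp only [termA, termB, hY]
    ring
  rw [Finset.sum_congr rfl hFeq, sum_list_map_swap]
  -- `|∑_t c ρρ Y_t| ≤ ∑_t ρρ |Y_t|`, then `Y_t = X_t`
  have hc : ∀ t ∈ T, |(t.1 : ℝ)| ≤ 1 := by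
    intro t ht
    obtain ⟨hc1, -⟩ := hterms t ht
    rcases hc1 with h | h <;> simp [h]
  have key := abs_list_sum_le T (fun t => (t.1 : ℝ))
    (fun t => (roughIndicator z t.2.1 * roughIndicator z t.2.2) *
      ∑ s' ∈ (Icc 1 (S / g)).filter (fun s' : ℕ => s'.Coprime (ThetaD a.natAbs d / g)), Y t s') hc
  have hrew : (T.map (fun t => (t.1 : ℝ) * ((roughIndicator z t.2.1 * roughIndicator z t.2.2) *
      ∑ s' ∈ (Icc 1 (S / g)).filter (fun s' : ℕ => s'.Coprime (ThetaD a.natAbs d / g)), Y t s'))) =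
      T.map (fun t => ∑ s' ∈ (Icc 1 (S / g)).filter (fun s' : ℕ => s'.Coprime (ThetaD a.natAbs d / g)),
        (t.1 : ℝ) * (roughIndicator z t.2.1 * roughIndicator z t.2.2) * Y t s') := by
    refine List.map_congr_left fun t _ => ?_
    rw [Finset.mul_sum, Finset.mul_sum]
    exact Finset.sum_congr rfl fun s' _ => by ring
  rw [hrew] at key
  refine key.trans (le_of_eq ?_)
  congr 1
  refine List.map_congr_left fun t _ => ?_
  rw [abs_mul, abs_of_nonneg (mul_nonneg (roughIndicator_nonneg z _) (roughIndicator_nonneg z _))]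
  congr 1
  -- convert the filter `(s', Θ_d/g) = 1` into `(s', ã l̃) = 1`: extra terms vanish
  unfold Xred
  simp only [hY]
  congr 1
  symm
  apply Finset.sum_subset
  · intro s' hs'
    rw [Finset.mem_filter] at hs' ⊢
    refine ⟨hs'.1, ?_⟩
    rw [coprime_ThetaD_div_iff ha hdA hgΘ]
    exact IsCoprime.of_mul_right_left hs'.2
  · intro s' hs' hns'
    rw [Finset.mem_filter] at hs' hns'
    have hcopA : IsCoprime (s' : ℤ) (a / (Ea a d g : ℤ)) := (coprime_ThetaD_div_iff ha hdA hgΘ s').1 hs'.2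
    -- so `s'` shares a prime with `l̃` which does not divide `ã`
    have hnl : ¬ IsCoprime (s' : ℤ) (((l * t.2.1 * t.2.2 / Ea a d g : ℕ) : ℤ)) := by
      intro h; exact hns' ⟨hs'.1, IsCoprime.mul_right hcopA h⟩
    rw [Int.isCoprime_iff_nat_coprime, Int.natAbs_natCast, Int.natAbs_natCast, Nat.Prime.not_coprime_iff_dvd] at hnl
    obtain ⟨p, hp, hps, hpl⟩ := hnl
    have hpa : ¬ (p : ℤ) ∣ a / (Ea a d g : ℤ) := by
      intro h
      have := Int.isCoprime_iff_gcd_eq_one.1 hcopA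
      rw [Int.gcd_eq_natAbs, Int.natAbs_natCast] at this
      have h2 : p ∣ Nat.gcd s' (a / (Ea a d g : ℤ)).natAbs := Nat.dvd_gcd hps (Int.natCast_dvd.1 h)
      rw [this] at h2
      exact hp.one_lt.ne' (Nat.dvd_one.1 h2)
    have hpw : p ∣ Pa a d g * (r * s') := hps.trans (Dvd.intro_left (Pa a d g * r) (by ring))
    rw [gcount_eq_zero_of_prime_dvd hpw hpl hpa, gmodel_eq_zero_of_prime_dvd hpw hpl hpa, sub_zero]

/-! ### Cells of the reduced ranges -/

/-- `sdiv (Ioc M₁ M₂) D = Ioc (M₁/D) (M₂/D)`. [folklore] -/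
theorem sdiv_Ioc {D : ℕ} (hD : 0 < D) (M₁ M₂ : ℕ) : sdiv (Ioc M₁ M₂) D = Ioc (M₁ / D) (M₂ / D) := by
  ext m'
  rw [mem_sdiv hD, Finset.mem_Ioc, Finset.mem_Ioc, Nat.div_lt_iff_lt_mul hD, Nat.le_div_iff_mul_le hD]
  constructor <;> rintro ⟨h1, h2⟩ <;> constructor <;> linarith [mul_comm D m']

/-- `gcount` over consecutive cells in `m`. [folklore] -/
theorem gcount_cells_M (a : ℤ) (z : ℝ) {b : ℕ → ℕ} (hb : Monotone b) (J : ℕ) (SN : Finset ℕ)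
    (lc L₀ w : ℕ) (lo hi : ℤ) :
    gcount a z (Ioc (b 0) (b J)) SN lc L₀ w lo hi =
      ∑ i ∈ range J, gcount a z (Ioc (b i) (b (i + 1))) SN lc L₀ w lo hi := by
  unfold gcount; exact sum_Ioc_eq_sum_cells hb _ J

/-- `gcount` over consecutive cells in `n`. [folklore] -/
theorem gcount_cells_N (a : ℤ) (z : ℝ) (SM : Finset ℕ) {b : ℕ → ℕ} (hb : Monotone b) (J : ℕ)
    (lc L₀ w : ℕ) (lo hi : ℤ) :
    gcount a z SM (Ioc (b 0) (b J)) lc L₀ w lo hi =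
      ∑ j ∈ range J, gcount a z SM (Ioc (b j) (b (j + 1))) lc L₀ w lo hi := by
  unfold gcount
  rw [Finset.sum_comm, sum_Ioc_eq_sum_cells hb _ J]
  exact Finset.sum_congr rfl fun j _ => Finset.sum_comm

/-- `gmodel` over consecutive cells in `m`. [folklore] -/
theorem gmodel_cells_M (a : ℤ) (z : ℝ) {b : ℕ → ℕ} (hb : Monotone b) (J : ℕ) (SN : Finset ℕ)
    (lc L₀ w : ℕ) (lo hi : ℤ) :
    gmodel a z (Ioc (b 0) (b J)) SN lc L₀ w lo hi =
      ∑ i ∈ range J, gmodel a z (Ioc (b i) (b (i + 1))) SN lc L₀ w lo hi := by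
  unfold gmodel; exact sum_Ioc_eq_sum_cells hb _ J

/-- `gmodel` over consecutive cells in `n`. [folklore] -/
theorem gmodel_cells_N (a : ℤ) (z : ℝ) (SM : Finset ℕ) {b : ℕ → ℕ} (hb : Monotone b) (J : ℕ)
    (lc L₀ w : ℕ) (lo hi : ℤ) :
    gmodel a z SM (Ioc (b 0) (b J)) lc L₀ w lo hi =
      ∑ j ∈ range J, gmodel a z SM (Ioc (b j) (b (j + 1))) lc L₀ w lo hi := by
  unfold gmodel
  rw [Finset.sum_comm, sum_Ioc_eq_sum_cells hb _ J]
  exact Finset.sum_congr rfl fun j _ => Finset.sum_comm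

/-- The window of the switched count in natural-number form: with `K = L₀ m n − a ≥ 0` and
`D = Q' g r`, `a + Q'r(gs') < L₀mn ≤ a + 2Q'r(gs') ⇔ D s' < K ≤ 2 D s'`. [folklore] -/
theorem window_iff_nat {a : ℤ} {L₀ m n K : ℕ} (hK : ((L₀ * m * n : ℕ) : ℤ) - a = K) (Q' r g s' : ℕ) :
    (a + (Q' : ℤ) * r * ((g * s' : ℕ) : ℤ) < ((L₀ * m * n : ℕ) : ℤ) ∧
        ((L₀ * m * n : ℕ) : ℤ) ≤ a + 2 * (Q' : ℤ) * r * ((g * s' : ℕ) : ℤ)) ↔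
      (Q' * g * r * s' < K ∧ K ≤ 2 * (Q' * g * r) * s') := by
  have hK' : ((L₀ * m * n : ℕ) : ℤ) = K + a := by linarith
  rw [hK']
  have e1 : (Q' : ℤ) * r * ((g * s' : ℕ) : ℤ) = ((Q' * g * r * s' : ℕ) : ℤ) := by push_cast; ring
  have e2 : 2 * (Q' : ℤ) * r * ((g * s' : ℕ) : ℤ) = ((2 * (Q' * g * r) * s' : ℕ) : ℤ) := by push_cast; ring
  rw [e1, e2]
  constructor
  · rintro ⟨h1, h2⟩
    constructor
    · have : ((Q' * g * r * s' : ℕ) : ℤ) < (K : ℤ) := by linarith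
      exact_mod_cast this
    · have : (K : ℤ) ≤ ((2 * (Q' * g * r) * s' : ℕ) : ℤ) := by linarith
      exact_mod_cast this
  · rintro ⟨h1, h2⟩
    have h1' : ((Q' * g * r * s' : ℕ) : ℤ) < (K : ℤ) := by exact_mod_cast h1
    have h2' : (K : ℤ) ≤ ((2 * (Q' * g * r) * s' : ℕ) : ℤ) := by exact_mod_cast h2
    constructor <;> linarith

/-- The natural number `L₀ x y − a` (meaningful when `a < L₀ x y`). [folklore] -/
def cellK (L₀ : ℕ) (a : ℤ) (x y : ℕ) : ℕ := (((L₀ * x * y : ℕ) : ℤ) - a).toNat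

/-- `cellK` is the integer `L₀ x y − a` when this is nonnegative. [folklore] -/
theorem cellK_cast {L₀ : ℕ} {a : ℤ} {x y : ℕ} (h : a ≤ ((L₀ * x * y : ℕ) : ℤ)) :
    ((cellK L₀ a x y : ℕ) : ℤ) = ((L₀ * x * y : ℕ) : ℤ) - a := by
  unfold cellK; rw [Int.toNat_of_nonneg (by linarith)]

/-- `cellK` is monotone in `(x, y)`. [folklore] -/
theorem cellK_mono {L₀ : ℕ} {a : ℤ} {x y x' y' : ℕ} (hx : x ≤ x') (hy : y ≤ y') :
    cellK L₀ a x y ≤ cellK L₀ a x' y' := by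
  unfold cellK
  apply Int.toNat_le_toNat
  have : L₀ * x * y ≤ L₀ * x' * y' := Nat.mul_le_mul (Nat.mul_le_mul_left _ hx) hy
  have : ((L₀ * x * y : ℕ) : ℤ) ≤ ((L₀ * x' * y' : ℕ) : ℤ) := by exact_mod_cast this
  linarith

/-- The ambiguous `s'`-contribution of one cell `(m₁, m₂] × (n₁, n₂]` for the reduced data:
`∑_{s' ≤ S_g ambiguous} (gcount + gmodel)`, where the ambiguous ranges are
`[⌈K₋/(2D₊)⌉, ⌈K₊/(2D₋)⌉ − 1] ∪ ((K₋−1)/D₊, (K₊−1)/D₋]`. [folklore] -/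
def ambCell (ared : ℤ) (z : ℝ) (m₁ m₂ n₁ n₂ lc L₀ R Sg Km Kp Dm Dp : ℕ) (lo hi : ℕ → ℤ) : ℝ :=
  ∑ s' ∈ (Icc 1 Sg).filter (fun s' : ℕ =>
      s' ∈ Icc ((Km + 2 * Dp - 1) / (2 * Dp)) ((Kp + 2 * Dm - 1) / (2 * Dm) - 1) ∨
        s' ∈ Ioc ((Km - 1) / Dp) ((Kp - 1) / Dm)),
    (gcount ared z (Ioc m₁ m₂) (Ioc n₁ n₂) lc L₀ (R * s') (lo s') (hi s') +
      gmodel ared z (Ioc m₁ m₂) (Ioc n₁ n₂) lc L₀ (R * s') (lo s') (hi s'))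

/-- `ambCell ≥ 0`. [folklore] -/
theorem ambCell_nonneg (ared : ℤ) (z : ℝ) (m₁ m₂ n₁ n₂ lc L₀ R Sg Km Kp Dm Dp : ℕ) (lo hi : ℕ → ℤ) :
    0 ≤ ambCell ared z m₁ m₂ n₁ n₂ lc L₀ R Sg Km Kp Dm Dp lo hi :=
  Finset.sum_nonneg fun _ _ => add_nonneg (gcount_nonneg _ _ _ _ _ _ _ _ _) (gmodel_nonneg _ _ _ _ _ _ _ _ _)

/-- `K = L₀ m n − a` on a cell, from an `l`-range: for `L₀ = l D` with `l ∈ [l₋, l₊]`,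
`m ∈ (m₁, m₂]`, `n ∈ (n₁, n₂]` and `a < l₋ D (m₁+1)(n₁+1)`:
`cellK (l₋ D) a (m₁+1) (n₁+1) ≤ K ≤ cellK (l₊ D) a m₂ n₂`. [folklore] -/
theorem exists_K_of_mem_cell {a : ℤ} {l lm lp D m₁ m₂ n₁ n₂ m n : ℕ} (hl : lm ≤ l ∧ l ≤ lp)
    (hm : m ∈ Ioc m₁ m₂) (hn : n ∈ Ioc n₁ n₂) (hpos : a < ((lm * D * (m₁ + 1) * (n₁ + 1) : ℕ) : ℤ)) :
    ∃ K : ℕ, ((l * D * m * n : ℕ) : ℤ) - a = K ∧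
      cellK (lm * D) a (m₁ + 1) (n₁ + 1) ≤ K ∧ K ≤ cellK (lp * D) a m₂ n₂ := by
  rw [Finset.mem_Ioc] at hm hn
  have h1 : lm * D * (m₁ + 1) * (n₁ + 1) ≤ l * D * m * n :=
    Nat.mul_le_mul (Nat.mul_le_mul (Nat.mul_le_mul_right _ hl.1) (by omega)) (by omega)
  have h2 : l * D * m * n ≤ lp * D * m₂ * n₂ :=
    Nat.mul_le_mul (Nat.mul_le_mul (Nat.mul_le_mul_right _ hl.2) hm.2) hn.2
  have h1' : ((lm * D * (m₁ + 1) * (n₁ + 1) : ℕ) : ℤ) ≤ ((l * D * m * n : ℕ) : ℤ) := by exact_mod_cast h1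
  have h2' : ((l * D * m * n : ℕ) : ℤ) ≤ ((lp * D * m₂ * n₂ : ℕ) : ℤ) := by exact_mod_cast h2
  refine ⟨(((l * D * m * n : ℕ) : ℤ) - a).toNat, (Int.toNat_of_nonneg (by linarith)).symm, ?_, ?_⟩
  · unfold cellK
    apply Int.toNat_le_toNat; linarith
  · unfold cellK
    apply Int.toNat_le_toNat; linarith

/-- **One cell of the reduced `s'`-sum**: for a cell `(m₁, m₂] × (n₁, n₂]` on which
`K = L₀mn − a ∈ [K₋, K₊]` (`K₋ ≥ 1`), `(K₋ − 1)/D₊ ≤ S_g`, moduli `R s'` with `(ared, R) = (lc, R) = 1`,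
and `r ∈ [r₋, r₊]` (`D± = Q' g r±`): the filtered `s'`-sum of `gcount − gmodel` is at most
`corners4(S₂) + corners4(S₁ − 1) + ambCell`, `S₂ = (K₋−1)/D₊`, `S₁ = ⌈K₊/(2D₋)⌉`.
[cite: BombieriFriedlanderIwaniecActa1986, §13 p. 241–242] -/
theorem abs_sum_one_cell_le {ared a : ℤ} (z : ℝ) {m₁ m₂ n₁ n₂ : ℕ} (hm : m₁ ≤ m₂) (hn : n₁ ≤ n₂)
    {lc L₀ R : ℕ} (haR : Nat.Coprime ared.natAbs R) (hlR : lc.Coprime R)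
    {Q' g r rm rp : ℕ} (hQ' : 0 < Q') (hg : 0 < g) (hrm : 0 < rm) (hr : rm ≤ r ∧ r ≤ rp)
    {Km Kp : ℕ} (hKm1 : 1 ≤ Km)
    (hKcell : ∀ m ∈ Ioc m₁ m₂, ∀ n ∈ Ioc n₁ n₂, ∃ K : ℕ, ((L₀ * m * n : ℕ) : ℤ) - a = K ∧ Km ≤ K ∧ K ≤ Kp)
    {Sg : ℕ} (hS : (Km - 1) / (Q' * g * rp) ≤ Sg) :
    |∑ s' ∈ (Icc 1 Sg).filter (fun s' : ℕ => IsCoprime (s' : ℤ) (ared * lc)),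
        (gcount ared z (Ioc m₁ m₂) (Ioc n₁ n₂) lc L₀ (R * s')
            (a + (Q' : ℤ) * r * ((g * s' : ℕ) : ℤ)) (a + 2 * (Q' : ℤ) * r * ((g * s' : ℕ) : ℤ)) -
          gmodel ared z (Ioc m₁ m₂) (Ioc n₁ n₂) lc L₀ (R * s')
            (a + (Q' : ℤ) * r * ((g * s' : ℕ) : ℤ)) (a + 2 * (Q' : ℤ) * r * ((g * s' : ℕ) : ℤ)))| ≤
      corners4 ared z m₁ m₂ n₁ n₂ ((Km - 1) / (Q' * g * rp)) R lc +
        corners4 ared z m₁ m₂ n₁ n₂ ((Kp + 2 * (Q' * g * rm) - 1) / (2 * (Q' * g * rm)) - 1) R lc +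
        ambCell ared z m₁ m₂ n₁ n₂ lc L₀ R Sg Km Kp (Q' * g * rm) (Q' * g * rp)
          (fun s' => a + (Q' : ℤ) * r * ((g * s' : ℕ) : ℤ)) (fun s' => a + 2 * (Q' : ℤ) * r * ((g * s' : ℕ) : ℤ)) := by
  set Dm := Q' * g * rm with hDm
  set Dp := Q' * g * rp with hDp
  set S₁ := (Kp + 2 * Dm - 1) / (2 * Dm) with hS₁
  set S₂ := (Km - 1) / Dp with hS₂
  set Slo := (Km + 2 * Dp - 1) / (2 * Dp) with hSlo
  set Shi := (Kp - 1) / Dm with hShi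
  have hDm0 : 0 < Dm := by rw [hDm]; positivity
  have hrp : 0 < rp := by omega
  have hDp0 : 0 < Dp := by rw [hDp]; positivity
  have hDmp : Dm ≤ Dp := by rw [hDm, hDp]; exact Nat.mul_le_mul_left _ (by omega)
  have hD : Dm ≤ Q' * g * r ∧ Q' * g * r ≤ Dp := by
    rw [hDm, hDp]; exact ⟨Nat.mul_le_mul_left _ hr.1, Nat.mul_le_mul_left _ hr.2⟩
  by_cases hKmp : Km ≤ Kp
  swap
  · -- then the cell is empty: everything vanishes
    have hempty : ∀ m ∈ Ioc m₁ m₂, ∀ n ∈ Ioc n₁ n₂, False := by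
      intro m hm' n hn'
      obtain ⟨K, -, h1, h2⟩ := hKcell m hm' n hn'
      omega
    have h0 : ∀ s' : ℕ, gcount ared z (Ioc m₁ m₂) (Ioc n₁ n₂) lc L₀ (R * s')
        (a + (Q' : ℤ) * r * ((g * s' : ℕ) : ℤ)) (a + 2 * (Q' : ℤ) * r * ((g * s' : ℕ) : ℤ)) = 0 ∧
        gmodel ared z (Ioc m₁ m₂) (Ioc n₁ n₂) lc L₀ (R * s')
        (a + (Q' : ℤ) * r * ((g * s' : ℕ) : ℤ)) (a + 2 * (Q' : ℤ) * r * ((g * s' : ℕ) : ℤ)) = 0 := by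
      intro s'
      exact ⟨gcount_eq_zero_of_window _ _ _ _ (fun m hm' n hn' => (hempty m hm' n hn').elim),
        gmodel_eq_zero_of_window _ _ _ _ (fun m hm' n hn' => (hempty m hm' n hn').elim)⟩
    rw [Finset.sum_eq_zero (fun s' _ => by rw [(h0 s').1, (h0 s').2, sub_zero]), abs_zero]
    have := corners4_nonneg ared z m₁ m₂ n₁ n₂ S₂ R lc
    have := corners4_nonneg ared z m₁ m₂ n₁ n₂ (S₁ - 1) R lc
    have := ambCell_nonneg ared z m₁ m₂ n₁ n₂ lc L₀ R Sg Km Kp Dm Dp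
      (fun s' => a + (Q' : ℤ) * r * ((g * s' : ℕ) : ℤ)) (fun s' => a + 2 * (Q' : ℤ) * r * ((g * s' : ℕ) : ℤ))
    linarith
  obtain ⟨hSlo1, hSloS₁, hS₂Shi⟩ := breakpoints_ordered hKmp hDmp hDm0 hKm1
  -- the cell lemma
  have hcell := abs_sum_cell_le ared z (Ioc m₁ m₂) (Ioc n₁ n₂) (lc := lc) (L₀ := L₀) (R := R) haR hlR
    (fun s' => a + (Q' : ℤ) * r * ((g * s' : ℕ) : ℤ)) (fun s' => a + 2 * (Q' : ℤ) * r * ((g * s' : ℕ) : ℤ))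
    (Smax := Sg) (S₁ := S₁) (S₂ := S₂) (Slo := Slo) (Shi := Shi) hSlo1 hSloS₁ hS
    (fun s' hs' m hm' n hn' => by
      obtain ⟨K, hK, hK1, hK2⟩ := hKcell m hm' n hn'
      rw [window_iff_nat hK]
      exact window_of_mem_inside ⟨hK1, hK2⟩ hD hDm0 hKm1 (Finset.mem_Icc.1 hs'))
    (fun s' hs' m hm' n hn' => by
      obtain ⟨K, hK, hK1, hK2⟩ := hKcell m hm' n hn'
      rw [window_iff_nat hK]
      exact not_window_of_outside ⟨hK1, hK2⟩ hD hDm0 hKm1 hs')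
  refine hcell.trans ?_
  have hamb : ∑ s' ∈ (Icc 1 Sg).filter (fun s' : ℕ => s' ∈ Icc Slo (S₁ - 1) ∨ s' ∈ Ioc S₂ Shi),
      (gcount ared z (Ioc m₁ m₂) (Ioc n₁ n₂) lc L₀ (R * s')
          (a + (Q' : ℤ) * r * ((g * s' : ℕ) : ℤ)) (a + 2 * (Q' : ℤ) * r * ((g * s' : ℕ) : ℤ)) +
        gmodel ared z (Ioc m₁ m₂) (Ioc n₁ n₂) lc L₀ (R * s')
          (a + (Q' : ℤ) * r * ((g * s' : ℕ) : ℤ)) (a + 2 * (Q' : ℤ) * r * ((g * s' : ℕ) : ℤ))) =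
      ambCell ared z m₁ m₂ n₁ n₂ lc L₀ R Sg Km Kp Dm Dp
        (fun s' => a + (Q' : ℤ) * r * ((g * s' : ℕ) : ℤ)) (fun s' => a + 2 * (Q' : ℤ) * r * ((g * s' : ℕ) : ℤ)) := by
    rfl
  rw [hamb]
  -- the inside window: `8` corners (or nothing if the window is empty)
  have hwin : |setQSum ared z (Ioc m₁ m₂) (Ioc n₁ n₂) (Icc S₁ S₂) R lc| ≤
      corners4 ared z m₁ m₂ n₁ n₂ S₂ R lc + corners4 ared z m₁ m₂ n₁ n₂ (S₁ - 1) R lc := by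
    by_cases hS12 : S₁ ≤ S₂ + 1
    · exact abs_setQSum_cell_le ared z hm hn (by omega) hS12 R lc
    · have : Icc S₁ S₂ = ∅ := Finset.Icc_eq_empty (by omega)
      rw [this]
      unfold setQSum
      simp only [Finset.filter_empty, Finset.sum_empty, abs_zero]
      exact add_nonneg (corners4_nonneg _ _ _ _ _ _ _ _ _) (corners4_nonneg _ _ _ _ _ _ _ _ _)
  linarith

/-! ### Coprimality of the reduced data -/

/-- The primes of `P` are the `U`-primes. [folklore] -/
theorem prime_dvd_Pa_iff {a : ℤ} {d g p : ℕ} (hp : p.Prime) :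
    p ∣ Pa a d g ↔ p ∈ Uset (psA a) a (d * g) := by
  unfold Pa Pred
  have hU : ∀ q ∈ Uset (psA a) a (d * g), q.Prime := fun q hq =>
    prime_of_mem_psA (List.mem_toFinset.1 (Uset_subset _ _ _ hq))
  rw [show (∏ q ∈ Uset (psA a) a (d * g), q) = ∏ q ∈ Uset (psA a) a (d * g), q ^ (fun _ => 1) q by simp,
    prime_dvd_prod_pow_iff hU _ hp]
  simp

/-- A `U`-prime does not divide `ã = a/E`. [folklore] -/
theorem not_dvd_ared_of_dvd_Pa {a : ℤ} (ha : a ≠ 0) {d g p : ℕ} (hp : p.Prime) (hpP : p ∣ Pa a d g) :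
    ¬ (p : ℤ) ∣ a / (Ea a d g : ℤ) := by
  rw [prime_dvd_Pa_iff hp] at hpP
  unfold Uset at hpP
  rw [Finset.mem_filter] at hpP
  unfold Ea
  intro h
  rw [show psA a = a.natAbs.primeFactors.sort (· ≤ ·) from rfl] at h
  rw [prime_dvd_div_Ered_iff ha (d * g) hp] at h
  exact h.2 hpP.2

/-- `(ã, P r) = 1` when `(r, a) = 1`. [folklore] -/
theorem coprime_ared_Pa_mul {a : ℤ} (ha : a ≠ 0) (d g : ℕ) {r : ℕ} (hrA : r.Coprime a.natAbs) :
    Nat.Coprime (a / (Ea a d g : ℤ)).natAbs (Pa a d g * r) := by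
  apply Nat.Coprime.mul_right
  · rw [Nat.coprime_comm, ← not_not (a := Nat.Coprime _ _), Nat.Prime.not_coprime_iff_dvd]
    rintro ⟨p, hp, hpP, hpa⟩
    exact not_dvd_ared_of_dvd_Pa ha hp hpP (Int.natCast_dvd.2 hpa)
  · -- `ã ∣ a` and `(r, a) = 1`
    have hE : (Ea a d g : ℤ) ∣ a := Int.natCast_dvd.2 (Ered_dvd (fun _ hp => prime_of_mem_psA hp) ha _)
    have hdiv : (a / (Ea a d g : ℤ)).natAbs ∣ a.natAbs := by
      rw [Int.natAbs_ediv_of_dvd hE, Int.natAbs_natCast]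
      exact Nat.div_dvd_of_dvd (Ered_dvd (fun _ hp => prime_of_mem_psA hp) ha _)
    exact Nat.Coprime.coprime_dvd_left hdiv hrA.symm

/-- If `l̃` shares a prime with `P`, the reduced sum vanishes. [folklore] -/
theorem Xred_eq_zero_of_not_coprime {a : ℤ} (ha : a ≠ 0) (z : ℝ) (SM SN : Finset ℕ) (l r Q' S d g : ℕ)
    (t : ℤ × ℕ × ℕ) (h : ¬ (l * t.2.1 * t.2.2 / Ea a d g).Coprime (Pa a d g)) :
    Xred a z SM SN l r Q' S d g t = 0 := by
  rw [Nat.Prime.not_coprime_iff_dvd] at h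
  obtain ⟨p, hp, hpl, hpP⟩ := h
  have hpa := not_dvd_ared_of_dvd_Pa ha hp hpP
  unfold Xred
  refine Finset.sum_eq_zero fun s' _ => ?_
  have hpw : p ∣ Pa a d g * (r * s') := hpP.trans (dvd_mul_right _ _)
  rw [gcount_eq_zero_of_prime_dvd hpw hpl hpa, gmodel_eq_zero_of_prime_dvd hpw hpl hpa, sub_zero]

/-! ### All cells: the reduced `s'`-sum of one `(r, l, t)` -/

/-- `(l̃, r) = 1`: the primes of `l̃ ∣ l D_m D_n` divide `l` or `a`. [folklore] -/
theorem coprime_lred {a : ℤ} (ha : a ≠ 0) {d g : ℕ} (hd : d ∣ a.natAbs) (hgΘ : g ∣ ThetaD a.natAbs d)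
    {l : ℕ} (hl : 0 < l) {t : ℤ × ℕ × ℕ} (ht : t ∈ Tsel a d g (profOf a l)) {r : ℕ}
    (hrA : r.Coprime a.natAbs) (hlr : l.Coprime r) :
    (l * t.2.1 * t.2.2 / Ea a d g).Coprime r := by
  obtain ⟨-, hterms, hident⟩ := Tsel_spec ha hd hgΘ (profOf a l)
  obtain ⟨-, -, -, hDdvd⟩ := hterms t ht
  obtain ⟨hEdvd, -⟩ := hident l hl (fun p hp => profOf_apply_of_mem hp)
  have hE : Ea a d g ∣ l * t.2.1 * t.2.2 := hEdvd t ht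
  by_contra hnc
  rw [Nat.Prime.not_coprime_iff_dvd] at hnc
  obtain ⟨p, hp, hpl, hpr⟩ := hnc
  have hpl' : p ∣ l * t.2.1 * t.2.2 := hpl.trans (Nat.div_dvd_of_dvd hE)
  rw [mul_assoc] at hpl'
  rcases (Nat.Prime.dvd_mul hp).1 hpl' with h | h
  · have := Nat.dvd_gcd h hpr; rw [hlr] at this; exact hp.one_lt.ne' (Nat.dvd_one.1 this)
  · have hpA : p ∣ a.natAbs := by
      have h2 : p ∣ ∏ q ∈ (psA a).toFinset, q ^ (padicValNat q a.natAbs + 1) := h.trans hDdvd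
      rw [prime_dvd_prod_pow_iff (fun q hq => prime_of_mem_psA (List.mem_toFinset.1 hq)) _ hp] at h2
      exact Nat.dvd_of_mem_primeFactors (mem_psA.1 (List.mem_toFinset.1 h2.1))
    have := Nat.dvd_gcd hpr hpA; rw [hrA] at this; exact hp.one_lt.ne' (Nat.dvd_one.1 this)

/-- **Subdivision of one reduced `s'`-sum.**  For `SM = (M₁, M₂]`, `SN = (N₁, N₂]`, monotone
breakpoints `b_m` from `M₁/D_m` to `M₂/D_m` and `b_n` from `N₁/D_n` to `N₂/D_n`, `r ∈ [r₋, r₊]`,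
`(r, a) = (l, r) = 1`, and bounds `K₋(i,j) ≤ l D_m D_n m n − a ≤ K₊(i,j)` on each cell (`K₋ ≥ 1`,
`(K₋ − 1)/(Q' g r₊) ≤ S/g`):
`|X_t(r,l)| ≤ ∑_{cells} (corners4(S₂) + corners4(S₁ − 1) + ambCell)` for the data `(ã, l̃, P r)`.
[cite: BombieriFriedlanderIwaniecActa1986, §13 p. 241–242] -/
theorem abs_Xred_le_sum_cells {a : ℤ} (ha : a ≠ 0) (z : ℝ) {M₁ M₂ N₁ N₂ : ℕ} {l r Q' S d g : ℕ}
    (hd : d ∣ a.natAbs) (hgΘ : g ∣ ThetaD a.natAbs d) (hl : 0 < l) {t : ℤ × ℕ × ℕ}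
    (ht : t ∈ Tsel a d g (profOf a l)) (hQ' : 0 < Q')
    (hrA : r.Coprime a.natAbs) (hlr : l.Coprime r) {rm rp : ℕ} (hrm : 0 < rm) (hr : rm ≤ r ∧ r ≤ rp)
    {bm bn : ℕ → ℕ} (hbm : Monotone bm) (hbn : Monotone bn) {Jm Jn : ℕ}
    (hbm0 : bm 0 = M₁ / t.2.1) (hbmJ : bm Jm = M₂ / t.2.1) (hbn0 : bn 0 = N₁ / t.2.2) (hbnJ : bn Jn = N₂ / t.2.2)
    {Km Kp : ℕ → ℕ → ℕ} (hKm1 : ∀ i j, 1 ≤ Km i j)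
    (hKcell : ∀ i j, ∀ m ∈ Ioc (bm i) (bm (i + 1)), ∀ n ∈ Ioc (bn j) (bn (j + 1)),
      ∃ K : ℕ, ((l * t.2.1 * t.2.2 * m * n : ℕ) : ℤ) - a = K ∧ Km i j ≤ K ∧ K ≤ Kp i j)
    (hS : ∀ i j, (Km i j - 1) / (Q' * g * rp) ≤ S / g) :
    |Xred a z (Ioc M₁ M₂) (Ioc N₁ N₂) l r Q' S d g t| ≤
      ∑ i ∈ range Jm, ∑ j ∈ range Jn,
        (corners4 (a / (Ea a d g : ℤ)) z (bm i) (bm (i + 1)) (bn j) (bn (j + 1))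
            ((Km i j - 1) / (Q' * g * rp)) (Pa a d g * r) (l * t.2.1 * t.2.2 / Ea a d g) +
          corners4 (a / (Ea a d g : ℤ)) z (bm i) (bm (i + 1)) (bn j) (bn (j + 1))
            ((Kp i j + 2 * (Q' * g * rm) - 1) / (2 * (Q' * g * rm)) - 1)
            (Pa a d g * r) (l * t.2.1 * t.2.2 / Ea a d g) +
          ambCell (a / (Ea a d g : ℤ)) z (bm i) (bm (i + 1)) (bn j) (bn (j + 1)) (l * t.2.1 * t.2.2 / Ea a d g)
            (l * t.2.1 * t.2.2) (Pa a d g * r) (S / g) (Km i j) (Kp i j) (Q' * g * rm) (Q' * g * rp)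
            (fun s' => a + (Q' : ℤ) * r * ((g * s' : ℕ) : ℤ)) (fun s' => a + 2 * (Q' : ℤ) * r * ((g * s' : ℕ) : ℤ))) := by
  have hg : 0 < g := Nat.pos_of_ne_zero fun h =>
    (ThetaD_pos a.natAbs d).ne' (by rw [h, zero_dvd_iff] at hgΘ; exact hgΘ)
  obtain ⟨-, hterms, -⟩ := Tsel_spec ha hd hgΘ (profOf a l)
  obtain ⟨-, hDm, hDn, -⟩ := hterms t ht
  set ared := a / (Ea a d g : ℤ) with hared
  set lc := l * t.2.1 * t.2.2 / Ea a d g with hlc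
  set L₀ := l * t.2.1 * t.2.2 with hL₀
  set R := Pa a d g * r with hR
  set lo : ℕ → ℤ := fun s' => a + (Q' : ℤ) * r * ((g * s' : ℕ) : ℤ) with hlo
  set hi : ℕ → ℤ := fun s' => a + 2 * (Q' : ℤ) * r * ((g * s' : ℕ) : ℤ) with hhi
  have hRHS0 : ∀ i j, 0 ≤ corners4 ared z (bm i) (bm (i + 1)) (bn j) (bn (j + 1))
            ((Km i j - 1) / (Q' * g * rp)) R lc +
          corners4 ared z (bm i) (bm (i + 1)) (bn j) (bn (j + 1))
            ((Kp i j + 2 * (Q' * g * rm) - 1) / (2 * (Q' * g * rm)) - 1) R lc +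
          ambCell ared z (bm i) (bm (i + 1)) (bn j) (bn (j + 1)) lc L₀ R (S / g) (Km i j) (Kp i j)
            (Q' * g * rm) (Q' * g * rp) lo hi := by
    intro i j
    have := corners4_nonneg ared z (bm i) (bm (i + 1)) (bn j) (bn (j + 1)) ((Km i j - 1) / (Q' * g * rp)) R lc
    have := corners4_nonneg ared z (bm i) (bm (i + 1)) (bn j) (bn (j + 1))
      ((Kp i j + 2 * (Q' * g * rm) - 1) / (2 * (Q' * g * rm)) - 1) R lc
    have := ambCell_nonneg ared z (bm i) (bm (i + 1)) (bn j) (bn (j + 1)) lc L₀ R (S / g) (Km i j) (Kp i j)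
      (Q' * g * rm) (Q' * g * rp) lo hi
    linarith
  -- if `(l̃, P) > 1` everything vanishes
  by_cases hcop : lc.Coprime (Pa a d g)
  swap
  · rw [Xred_eq_zero_of_not_coprime ha z _ _ l r Q' S d g t hcop, abs_zero]
    exact Finset.sum_nonneg fun i _ => Finset.sum_nonneg fun j _ => hRHS0 i j
  -- coprimality of the data
  have haR : Nat.Coprime ared.natAbs R := coprime_ared_Pa_mul ha d g hrA
  have hlR : lc.Coprime R := Nat.Coprime.mul_right hcop (coprime_lred ha hd hgΘ hl ht hrA hlr)
  -- split the ranges into cells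
  set F : ℕ → ℕ → ℕ → ℝ := fun i j s' =>
    gcount ared z (Ioc (bm i) (bm (i + 1))) (Ioc (bn j) (bn (j + 1))) lc L₀ (R * s') (lo s') (hi s') -
      gmodel ared z (Ioc (bm i) (bm (i + 1))) (Ioc (bn j) (bn (j + 1))) lc L₀ (R * s') (lo s') (hi s') with hF
  have hsplit : ∀ s' : ℕ,
      gcount ared z (sdiv (Ioc M₁ M₂) t.2.1) (sdiv (Ioc N₁ N₂) t.2.2) lc L₀ (Pa a d g * (r * s')) (lo s') (hi s') -
        gmodel ared z (sdiv (Ioc M₁ M₂) t.2.1) (sdiv (Ioc N₁ N₂) t.2.2) lc L₀ (Pa a d g * (r * s')) (lo s') (hi s') =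
      ∑ i ∈ range Jm, ∑ j ∈ range Jn, F i j s' := by
    intro s'
    rw [sdiv_Ioc hDm, sdiv_Ioc hDn, ← hbm0, ← hbmJ, ← hbn0, ← hbnJ, ← mul_assoc, ← hR,
      gcount_cells_M ared z hbm Jm, gmodel_cells_M ared z hbm Jm, ← Finset.sum_sub_distrib]
    refine Finset.sum_congr rfl fun i _ => ?_
    rw [gcount_cells_N ared z _ hbn Jn, gmodel_cells_N ared z _ hbn Jn, ← Finset.sum_sub_distrib]
  unfold Xred
  simp only [← hared, ← hlc, ← hL₀]
  rw [Finset.sum_congr rfl fun s' _ => hsplit s', Finset.sum_comm]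
  refine (Finset.abs_sum_le_sum_abs _ _).trans (Finset.sum_le_sum fun i _ => ?_)
  rw [Finset.sum_comm]
  refine (Finset.abs_sum_le_sum_abs _ _).trans (Finset.sum_le_sum fun j _ => ?_)
  -- one cell
  have hm : bm i ≤ bm (i + 1) := hbm (Nat.le_succ i)
  have hn : bn j ≤ bn (j + 1) := hbn (Nat.le_succ j)
  have hKcell' : ∀ m ∈ Ioc (bm i) (bm (i + 1)), ∀ n ∈ Ioc (bn j) (bn (j + 1)),
      ∃ K : ℕ, ((L₀ * m * n : ℕ) : ℤ) - a = K ∧ Km i j ≤ K ∧ K ≤ Kp i j := hKcell i j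
  have hcell := abs_sum_one_cell_le (ared := ared) (a := a) z hm hn haR hlR hQ' hg hrm hr (hKm1 i j) hKcell' (hS i j)
  simp only [hF]
  exact hcell

/-! ### The reduced complementary divisor on the ambiguous ranges -/

/-- **On the ambiguous ranges the reduced complementary divisor lies in two short windows.**
With `D = Q' g r`, `r ∈ [r₋, r₊]`, `K ∈ [K₋, K₊]`, the window `D s' < K ≤ 2 D s'` and the reduced
factorisation `K = E P q̃ r s'`: `Q' g < E P q̃ ≤ 2 Q' g`; moreover `s' ≤ ⌈K₊/(2Q'g r₋)⌉ − 1` forces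
`q̃ > 2Q'g r₋ K₋/(E P r₊ K₊)` and `s' > (K₋−1)/(Q' g r₊)` forces `q̃ ≤ Q' g r₊ K₊/(E P r₋ K₋)`.
[cite: BombieriFriedlanderIwaniecActa1986, §13 p. 241–242] -/
theorem mem_ambiguous_windows_red {Q' g rm rp r Km Kp K s' E P q : ℕ}
    (hr : rm ≤ r ∧ r ≤ rp) (hrm : 0 < rm) (hK : Km ≤ K ∧ K ≤ Kp) (hKm : 0 < Km)
    (hwin : Q' * g * r * s' < K ∧ K ≤ 2 * (Q' * g * r) * s') (hq : E * P * q * (r * s') = K) :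
    (Q' * g < E * P * q ∧ E * P * q ≤ 2 * (Q' * g)) ∧
      (s' ≤ (Kp + 2 * (Q' * g * rm) - 1) / (2 * (Q' * g * rm)) - 1 →
        2 * (Q' * g) * rm * Km / (E * P * rp * Kp) < q) ∧
      ((Km - 1) / (Q' * g * rp) < s' → q ≤ Q' * g * rp * Kp / (E * P * rm * Km)) := by
  obtain ⟨hw1, hw2⟩ := hwin
  have hr0 : 0 < r := by omega
  have hs0 : 0 < s' := by
    rcases Nat.eq_zero_or_pos s' with h | h
    · rw [h] at hw2; simp at hw2; omega
    · exact h
  have hrs : 0 < r * s' := Nat.mul_pos hr0 hs0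
  have hK0 : 0 < K := by omega
  have hEPq : 0 < E * P * q := by
    rcases Nat.eq_zero_or_pos (E * P * q) with h | h
    · rw [h, zero_mul] at hq; omega
    · exact h
  refine ⟨⟨?_, ?_⟩, ?_, ?_⟩
  · -- `Q' g (r s') < K = E P q (r s')`
    have : Q' * g * (r * s') < E * P * q * (r * s') := by rw [hq]; linarith [mul_assoc (Q' * g) r s']
    exact Nat.lt_of_mul_lt_mul_right this
  · have : E * P * q * (r * s') ≤ 2 * (Q' * g) * (r * s') := by rw [hq]; linarith [mul_assoc (Q' * g) r s']
    exact Nat.le_of_mul_le_mul_right this hrs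
  · intro hs
    have hDm : 0 < 2 * (Q' * g * rm) := by
      have : 0 < Q' * g := by
        rcases Nat.eq_zero_or_pos (Q' * g) with h | h
        · exfalso; rw [h] at hw2; simp at hw2; omega
        · exact h
      positivity
    have hKp : 0 < Kp := by omega
    have h1 : s' * (2 * (Q' * g * rm)) < Kp :=
      lt_of_le_of_lt (Nat.mul_le_mul_right _ hs) (ceilDiv_pred_mul_lt hKp hDm)
    have hEP : 0 < E * P := Nat.pos_of_ne_zero fun h => by
      rw [h, zero_mul] at hEPq; exact lt_irrefl 0 hEPq
    have hden : 0 < E * P * rp * Kp := Nat.mul_pos (Nat.mul_pos hEP (by omega)) hKp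
    rw [Nat.div_lt_iff_lt_mul hden]
    calc 2 * (Q' * g) * rm * Km ≤ 2 * (Q' * g) * rm * K := Nat.mul_le_mul_left _ hK.1
      _ = E * P * q * r * (s' * (2 * (Q' * g * rm))) := by rw [← hq]; ring
      _ < E * P * q * r * Kp := Nat.mul_lt_mul_of_pos_left h1 (by positivity)
      _ ≤ E * P * q * rp * Kp := by
          apply Nat.mul_le_mul_right; exact Nat.mul_le_mul_left _ hr.2
      _ = q * (E * P * rp * Kp) := by ring
  · intro hs
    have hDp : 0 < Q' * g * rp := by
      have : 0 < Q' * g := by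
        rcases Nat.eq_zero_or_pos (Q' * g) with h | h
        · exfalso; rw [h] at hw2; simp at hw2; omega
        · exact h
      have : 0 < rp := by omega
      positivity
    have h1 : Km ≤ s' * (Q' * g * rp) := by
      have h1' : (Km - 1) / (Q' * g * rp) + 1 ≤ s' := hs
      have h2' : Km - 1 < ((Km - 1) / (Q' * g * rp) + 1) * (Q' * g * rp) := by
        have := Nat.lt_div_mul_add (a := Km - 1) hDp
        nlinarith
      have h3' := Nat.mul_le_mul_right (Q' * g * rp) h1'
      omega
    have hEP : 0 < E * P := Nat.pos_of_ne_zero fun h => by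
      rw [h, zero_mul] at hEPq; exact lt_irrefl 0 hEPq
    have hden : 0 < E * P * rm * Km := Nat.mul_pos (Nat.mul_pos hEP hrm) hKm
    rw [Nat.le_div_iff_mul_le hden]
    calc q * (E * P * rm * Km) ≤ q * (E * P * r * Km) := by
          apply Nat.mul_le_mul_left; apply Nat.mul_le_mul_right; exact Nat.mul_le_mul_left _ hr.1
      _ ≤ q * (E * P * r * (s' * (Q' * g * rp))) := by
          apply Nat.mul_le_mul_left; exact Nat.mul_le_mul_left _ h1
      _ = E * P * q * (r * s') * (Q' * g * rp) := by ring
      _ = K * (Q' * g * rp) := by rw [hq]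
      _ ≤ Kp * (Q' * g * rp) := Nat.mul_le_mul_right _ hK.2
      _ = Q' * g * rp * Kp := by ring

/-! ### From `(r, l)`-sums of corners to `Δ*` for the reduced data -/

/-- **Embedding into `Δ*` of the reduced data.**  For injective relabellings `r ↦ r'`, `l ↦ l'`
and weights `w ≤ 1` supported where `(r', ã) = 1`, `(l', r') = 1` and `l'` is `z`-rough:
`∑_{r ∈ C_r} ∑_{l ∈ C_l} w(r,l) |setQSum ã (…) r' l'| ≤ deltaStarSets ã (…) (l'(C_l)) SQ (r'(C_r))`.
[folklore] -/
theorem sum_mul_abs_setQSum_le_deltaStarSets (ared : ℤ) (z : ℝ) (SM SN SQ Cr Cl : Finset ℕ)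
    (fr fl : ℕ → ℕ) (w : ℕ → ℕ → ℝ) (hinjr : Set.InjOn fr Cr) (hinjl : Set.InjOn fl Cl)
    (hw1 : ∀ r l, w r l ≤ 1)
    (hw : ∀ r ∈ Cr, ∀ l ∈ Cl, w r l ≠ 0 →
      IsCoprime ((fr r : ℕ) : ℤ) ared ∧ (fl l).Coprime (fr r) ∧ roughIndicator z (fl l) = 1) :
    ∑ r ∈ Cr, ∑ l ∈ Cl, w r l * |setQSum ared z SM SN SQ (fr r) (fl l)| ≤
      deltaStarSets ared z SM SN (Cl.image fl) SQ (Cr.image fr) := by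
  unfold deltaStarSets
  rw [Finset.sum_filter, Finset.sum_image hinjr]
  refine Finset.sum_le_sum fun r hr => ?_
  by_cases hcr : IsCoprime ((fr r : ℕ) : ℤ) ared
  · rw [if_pos hcr, Finset.sum_filter, Finset.sum_image hinjl]
    refine Finset.sum_le_sum fun l hl => ?_
    by_cases hwz : w r l = 0
    · rw [hwz, zero_mul]
      split_ifs
      · exact mul_nonneg (roughIndicator_nonneg z _) (abs_nonneg _)
      · exact le_rfl
    · obtain ⟨-, hcl, hρ⟩ := hw r hr l hl hwz
      rw [if_pos hcl, hρ, one_mul]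
      exact (mul_le_mul_of_nonneg_right (hw1 r l) (abs_nonneg _)).trans (by rw [one_mul])
  · rw [if_neg hcr]
    apply Finset.sum_nonpos
    intro l hl
    by_cases hwz : w r l = 0
    · rw [hwz, zero_mul]
    · exact absurd (hw r hr l hl hwz).1 hcr

end BFI

end Literature.NumberTheory.Sieve
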